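import Mathlib
import HarnessLib

/-!
# Classical lattice data of the FLUID COMPUTER cell: the Taylor–Green and Kida–Pelz initial velocity fields

HONEST FRAMING (cell `pub-fluidc`, verbatim): *low prior, high value-of-information experiment on
Tao's machine paradigm; NOT a claim that NS blows up.* This file contains NO statement about the
Navier–Stokes or Euler evolution. It records, as closed forms on `ℝ³` (coordinates `x y z : ℝ`,
`2π`-periodic in each), the two classical high-symmetry initial data that the cell's `CL-tg` /
`CL-kp` lattice families, its strip gates (G-strip-1/2) and its 1024³ reference tier integrate,
and proves the exact pointwise identities that the cell's bookkeeping relies on: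

* `TaylorGreen.u, v, w` — `u = sin x cos y cos z`, `v = -cos x sin y cos z`, `w = 0`
  [cite: VanReesEtAl2011VortexSpectral, eq. (10)] (the `θ = 0` member of the family of
  [cite: BrachetEtAl1983, §1], cite-only in this cell); as used by the gate G1-a and, inviscid, by [cite: BustamanteBrachet2012, §2].
* `KidaPelz.u, v, w` — `u = sin x (cos 3y cos z - cos y cos 3z)`, `v(x,y,z) = u(y,z,x)`,
  `w(x,y,z) = u(z,x,y)` [cite: CichowlasBrachet2005, eq. (4)]; the high-symmetry flow of
  [cite: Kida1985] in the form of [cite: BoratavPelz1994].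

For each datum: (i) the divergence `∂ₓu + ∂_y v + ∂_z w` vanishes identically
(`TaylorGreen.div_eq_zero`, `KidaPelz.div_eq_zero`); (ii) every component is an eigenfunction of
the Laplacian, `Δuᵢ = -3 uᵢ` for Taylor–Green and `Δuᵢ = -11 uᵢ` for Kida–Pelz
(`TaylorGreen.laplacian_u` …, `KidaPelz.laplacian_u` …) — i.e. all the energy sits on the single
Fourier shell `|k|² = 3`, resp. `|k|² = 1 + 9 + 1 = 11`; hence the atlas's "named-flow wavenumber
pins" `k₀ = √3`, resp. `√11` (SCHEMA 9.12). (iii) For Kida–Pelz the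
cyclic symmetry is definitional and the parities `u(-x,y,z) = -u(x,y,z)`, `u(x,-y,z) = u(x,y,-z) =
u(x,y,z)` are recorded; the full octahedral invariance [cite: CichowlasBrachet2005, p. 240] is not.
(iv) (v2) The CELL AVERAGES the cell's solvers print as their `t = 0` sanity line
(HOME/LITERATURE.md §C1, §C9.1; GRID's native-IC validation of 2026-08-19T08:41Z): with
`⟨·⟩` the volume average over `[0,2π]³` written as an iterated interval integral (`cellMean`),
`E = ½⟨|u|²⟩` (`cellEnergy`), `Z = ½⟨|ω|²⟩` (`cellEnstrophy`, vorticity `vorticity₁,₂,₃` by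
coordinate-line derivatives) and `H = ⟨u·ω⟩` (`cellHelicity`):
Taylor–Green `ω = (-cos x sin y sin z, -sin x cos y sin z, 2 sin x sin y cos z)`,
**`E(0) = 1/8`, `Z(0) = 3/8 = 3 E(0)`, `H(0) = 0`** (helicity density vanishes pointwise);
Kida–Pelz `ω₁ = -2 cos 3x sin y sin z + 3 cos x (sin 3y sin z + sin y sin 3z)` and cyclic images,
**`E(0) = 3/8`, `Z(0) = 33/8 = 11 E(0)`, `H(0) = 0`** — elementary values (derived, not printed
as numbers in the sources; the `t = 0` end of the enstrophy curves of [cite: CichowlasBrachet2005,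
Fig. 1]) that GRID measured on the built field as `E(0) = 0.3749999`, `Z(0) = 4.1249989` (single
precision). (v) (v2) The Taylor–Green initial
PRESSURE `p = (cos 2x + cos 2y)(cos 2z + 2)/16` [cite: DeBonis2013TaylorGreen, eq. (10)] solves the
pressure-Poisson equation `Δp = -∂ᵢuⱼ∂ⱼuᵢ` pointwise (`TaylorGreen.pressurePoisson`), i.e. the
printed `(u, p)` is a consistent incompressible initial state. (vi) (v3) The Taylor–Green SUP NORMS
of the cell's t = 0 sanity line: `|u|² ≤ 1` and `|ω|² ≤ 4` pointwise, both attained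
(`TaylorGreen.speed_sq_le_one`, `speed_sq_eq_one_at`, `vorticity_sq_le_four`,
`vorticity_sq_eq_four_at`), i.e. **`‖u(0)‖_∞ = 1`, `‖ω(0)‖_∞ = 2`**. (vii) (v4) FACTORISED closed
forms of the Kida–Pelz datum and vorticity (triple-angle formulas): `u = 4 sin x cos y cos z
(sin²z - sin²y)` (`KidaPelz.u_eq_factored` — `u` vanishes on the diagonal planes `y ≡ ±z mod π`
as well as on the coordinate planes) and `ω₁ = 4 cos x sin y sin z (4 + 2 sin²x - 3 sin²y - 3 sin²z)`
(`KidaPelz.vorticity₁_eq_factored`); `|ω₁| ≤ 8` pointwise (`abs_vorticity₁_le`) and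
`ω(0, π/2, π/2) = (-8, 0, 0)` (`vorticity_at_max`): the cell's KP sanity number `‖ω(0)‖_∞ = 8` is
attained and each component is bounded by it. (viii) (v5, cell pub-fluidc lit gen 18) THE FULL-VECTOR
BOUND **`|ω|² ≤ 64` pointwise** (`KidaPelz.vorticity_sq_le`, attained: `vorticity_sq_eq_at_max`), i.e.
**`‖ω(0)‖_∞ = 8` exactly** for the Kida–Pelz datum: with `a, b, c = sin²x, sin²y, sin²z` it is the cube
inequality `Σ_cyc (1−a) b c (4+2a−3b−3c)² ≤ 4` (`KidaPelz.cube_ineq`), proved by a degree-6 HANDELMAN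
certificate — `4 − Σ_cyc …` is a positive rational combination of 65 products of `a, 1−a, b, 1−b, c, 1−c`
(found by linear programming, kit job j068504 of the lit seat; `linarith` re-derives it in the kernel
from the listed products). The companion `‖u(0)‖_∞ = 3√6/4` (maximum of `Σ_cyc a(1−b)(1−c)(c−b)² = 27/128`
at `(a,b,c) = (3/4,3/4,0)`, an interior point of a face — no Handelman certificate can be tight there)
remains untyped.

Design: partial derivatives are taken along coordinate lines with the one-variable `deriv`, so
that no `fderiv` bookkeeping on `ℝ³` is needed; second derivatives are `deriv (deriv ·)` of the
coordinate-line restriction. Everything is `HasDerivAt` calculus for `sin`/`cos` plus `ring`.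
The cell averages of (iv) are ITERATED interval integrals over `[0,2π]`, innermost first; every
inner integral of these trigonometric polynomials is evaluated in closed form before the next is
taken (toolkit `PeriodIntegral.*`: `∫₀^{2π} cos nx = ∫₀^{2π} sin nx = 0`, the squares, and the
mode-orthogonality products that occur), so no Fubini or measurability bookkeeping is needed.
What is deliberately NOT here: periodicity/torus packaging, the octahedral group action (see
`LatticeSymmetry` for the Fourier-side version), the ABC flow
(`ABCFlowData.lean` in this directory), and anything time-dependent.
-/

noncomputable section

namespace Literature.Analysis.FluidPDE.FluidComputer

open Real

/-! ## Two calculus helpers -/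

/-- `d/dr cos(a r) = -a sin(a r)`. [folklore] -/
theorem hasDerivAt_cos_const_mul (a s : ℝ) :
    HasDerivAt (fun r : ℝ => cos (a * r)) (-(a * sin (a * s))) s := by
  have h := ((hasDerivAt_id s).const_mul a).cos
  simp only [id_eq] at h
  convert h using 1
  ring

/-- `d/dr sin(a r) = a cos(a r)`. [folklore] -/
theorem hasDerivAt_sin_const_mul (a s : ℝ) :
    HasDerivAt (fun r : ℝ => sin (a * r)) (a * cos (a * s)) s := by
  have h := ((hasDerivAt_id s).const_mul a).sin
  simp only [id_eq] at h
  convert h using 1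
  ring

/-! ## Taylor–Green -/

namespace TaylorGreen

/-- First component of the Taylor–Green datum, `u(x,y,z) = sin x cos y cos z` (the `θ = 0`
member of the Brachet et al. 1983 family). [cite: VanReesEtAl2011VortexSpectral, eq. (10)] -/
def u (x y z : ℝ) : ℝ := sin x * cos y * cos z

/-- Second component, `v(x,y,z) = -cos x sin y cos z`. [cite: VanReesEtAl2011VortexSpectral, eq. (10)] -/
def v (x y z : ℝ) : ℝ := -(cos x * sin y * cos z)

/-- Third component, `w = 0`. [cite: VanReesEtAl2011VortexSpectral, eq. (10)] -/
def w (_x _y _z : ℝ) : ℝ := 0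

/-- `∂ₓ u = cos x cos y cos z`. [folklore] -/
theorem hasDerivAt_u_x (x y z : ℝ) :
    HasDerivAt (fun s => u s y z) (cos x * cos y * cos z) x := by
  unfold u
  exact ((hasDerivAt_sin x).mul_const (cos y)).mul_const (cos z)

/-- `∂_y v = -cos x cos y cos z`. [folklore] -/
theorem hasDerivAt_v_y (x y z : ℝ) :
    HasDerivAt (fun s => v x s z) (-(cos x * cos y * cos z)) y := by
  unfold v
  exact (((hasDerivAt_sin y).const_mul (cos x)).mul_const (cos z)).fun_neg

/-- `∂_z w = 0`. [folklore] -/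
theorem hasDerivAt_w_z (x y z : ℝ) : HasDerivAt (fun s => w x y s) 0 z := by
  unfold w
  exact hasDerivAt_const z 0

/-- **The Taylor–Green datum is divergence-free**: `∂ₓu + ∂_y v + ∂_z w = 0` at every point.
[folklore] -/
theorem div_eq_zero (x y z : ℝ) :
    deriv (fun s => u s y z) x + deriv (fun s => v x s z) y + deriv (fun s => w x y s) z = 0 := by
  rw [(hasDerivAt_u_x x y z).deriv, (hasDerivAt_v_y x y z).deriv, (hasDerivAt_w_z x y z).deriv]
  ring

/-- Second derivative of `u` along `x`: `∂ₓ² u = -u`. [folklore] -/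
theorem deriv2_u_x (x y z : ℝ) :
    deriv (fun s => deriv (fun r => u r y z) s) x = -u x y z := by
  have h1 : ∀ s, HasDerivAt (fun r => u r y z) (cos s * cos y * cos z) s := fun s =>
    hasDerivAt_u_x s y z
  have hfun : (fun s => deriv (fun r => u r y z) s) = fun s => cos s * cos y * cos z :=
    funext fun s => (h1 s).deriv
  rw [hfun]
  have h2 : HasDerivAt (fun s => cos s * cos y * cos z) (-sin x * cos y * cos z) x :=
    ((hasDerivAt_cos x).mul_const (cos y)).mul_const (cos z)
  rw [h2.deriv]
  unfold u; ring

/-- Second derivative of `u` along `y`: `∂_y² u = -u`. [folklore] -/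
theorem deriv2_u_y (x y z : ℝ) :
    deriv (fun s => deriv (fun r => u x r z) s) y = -u x y z := by
  have h1 : ∀ s, HasDerivAt (fun r => u x r z) (sin x * (-sin s) * cos z) s := fun s => by
    unfold u
    exact ((hasDerivAt_cos s).const_mul (sin x)).mul_const (cos z)
  have hfun : (fun s => deriv (fun r => u x r z) s) = fun s => sin x * (-sin s) * cos z :=
    funext fun s => (h1 s).deriv
  rw [hfun]
  have h2 : HasDerivAt (fun s => sin x * (-sin s) * cos z) (sin x * (-cos y) * cos z) y :=
    ((hasDerivAt_sin y).fun_neg.const_mul (sin x)).mul_const (cos z)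
  rw [h2.deriv]
  unfold u; ring

/-- Second derivative of `u` along `z`: `∂_z² u = -u`. [folklore] -/
theorem deriv2_u_z (x y z : ℝ) :
    deriv (fun s => deriv (fun r => u x y r) s) z = -u x y z := by
  have h1 : ∀ s, HasDerivAt (fun r => u x y r) (sin x * cos y * (-sin s)) s := fun s => by
    unfold u
    exact (hasDerivAt_cos s).const_mul (sin x * cos y)
  have hfun : (fun s => deriv (fun r => u x y r) s) = fun s => sin x * cos y * (-sin s) :=
    funext fun s => (h1 s).deriv
  rw [hfun]
  have h2 : HasDerivAt (fun s => sin x * cos y * (-sin s)) (sin x * cos y * (-cos z)) z :=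
    (hasDerivAt_sin z).fun_neg.const_mul (sin x * cos y)
  rw [h2.deriv]
  unfold u; ring

/-- **`u` is a Laplace eigenfunction with eigenvalue `-3`**: `∂ₓ²u + ∂_y²u + ∂_z²u = -3u`
(all energy on the shell `|k|² = 3`; the cell's `k₀ = √3` pin and `Z(0) = 3 E(0)`).
[folklore] -/
theorem laplacian_u (x y z : ℝ) :
    deriv (fun s => deriv (fun r => u r y z) s) x + deriv (fun s => deriv (fun r => u x r z) s) y +
      deriv (fun s => deriv (fun r => u x y r) s) z = -3 * u x y z := by
  rw [deriv2_u_x, deriv2_u_y, deriv2_u_z]; ring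

/-- Second derivative of `v` along `x`: `∂ₓ² v = -v`. [folklore] -/
theorem deriv2_v_x (x y z : ℝ) :
    deriv (fun s => deriv (fun r => v r y z) s) x = -v x y z := by
  have h1 : ∀ s, HasDerivAt (fun r => v r y z) (-(-sin s * sin y * cos z)) s := fun s => by
    unfold v
    exact (((hasDerivAt_cos s).mul_const (sin y)).mul_const (cos z)).fun_neg
  have hfun : (fun s => deriv (fun r => v r y z) s) = fun s => -(-sin s * sin y * cos z) :=
    funext fun s => (h1 s).deriv
  rw [hfun]
  have h2 : HasDerivAt (fun s => -(-sin s * sin y * cos z)) (-(-cos x * sin y * cos z)) x :=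
    (((hasDerivAt_sin x).fun_neg.mul_const (sin y)).mul_const (cos z)).fun_neg
  rw [h2.deriv]
  unfold v; ring

/-- Second derivative of `v` along `y`: `∂_y² v = -v`. [folklore] -/
theorem deriv2_v_y (x y z : ℝ) :
    deriv (fun s => deriv (fun r => v x r z) s) y = -v x y z := by
  have h1 : ∀ s, HasDerivAt (fun r => v x r z) (-(cos x * cos s * cos z)) s := fun s => by
    unfold v
    exact (((hasDerivAt_sin s).const_mul (cos x)).mul_const (cos z)).fun_neg
  have hfun : (fun s => deriv (fun r => v x r z) s) = fun s => -(cos x * cos s * cos z) :=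
    funext fun s => (h1 s).deriv
  rw [hfun]
  have h2 : HasDerivAt (fun s => -(cos x * cos s * cos z)) (-(cos x * (-sin y) * cos z)) y :=
    (((hasDerivAt_cos y).const_mul (cos x)).mul_const (cos z)).fun_neg
  rw [h2.deriv]
  unfold v; ring

/-- Second derivative of `v` along `z`: `∂_z² v = -v`. [folklore] -/
theorem deriv2_v_z (x y z : ℝ) :
    deriv (fun s => deriv (fun r => v x y r) s) z = -v x y z := by
  have h1 : ∀ s, HasDerivAt (fun r => v x y r) (-(cos x * sin y * (-sin s))) s := fun s => by
    unfold v
    exact ((hasDerivAt_cos s).const_mul (cos x * sin y)).fun_neg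
  have hfun : (fun s => deriv (fun r => v x y r) s) = fun s => -(cos x * sin y * (-sin s)) :=
    funext fun s => (h1 s).deriv
  rw [hfun]
  have h2 : HasDerivAt (fun s => -(cos x * sin y * (-sin s))) (-(cos x * sin y * (-cos z))) z :=
    ((hasDerivAt_sin z).fun_neg.const_mul (cos x * sin y)).fun_neg
  rw [h2.deriv]
  unfold v; ring

/-- **`v` is a Laplace eigenfunction with eigenvalue `-3`.** [folklore] -/
theorem laplacian_v (x y z : ℝ) :
    deriv (fun s => deriv (fun r => v r y z) s) x + deriv (fun s => deriv (fun r => v x r z) s) y +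
      deriv (fun s => deriv (fun r => v x y r) s) z = -3 * v x y z := by
  rw [deriv2_v_x, deriv2_v_y, deriv2_v_z]; ring

/-- The third component is identically zero, so its Laplacian is trivially `-3 w = 0`. [folklore] -/
theorem laplacian_w (x y z : ℝ) :
    deriv (fun s => deriv (fun r => w r y z) s) x + deriv (fun s => deriv (fun r => w x r z) s) y +
      deriv (fun s => deriv (fun r => w x y r) s) z = -3 * w x y z := by
  simp [w]

end TaylorGreen

/-! ## Kida–Pelz -/

namespace KidaPelz

/-- First component of the Kida–Pelz datum, `u(x,y,z) = sin x (cos 3y cos z - cos y cos 3z)`.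
[cite: CichowlasBrachet2005, eq. (4)] -/
def u (x y z : ℝ) : ℝ := sin x * (cos (3 * y) * cos z - cos y * cos (3 * z))

/-- Second component, by cyclic permutation: `v(x,y,z) = u(y,z,x)`. [cite: CichowlasBrachet2005, eq. (4)] -/
def v (x y z : ℝ) : ℝ := u y z x

/-- Third component, by cyclic permutation: `w(x,y,z) = u(z,x,y)`. [cite: CichowlasBrachet2005, eq. (4)] -/
def w (x y z : ℝ) : ℝ := u z x y

/-- The printed closed form of `v`: `sin y (cos 3z cos x - cos z cos 3x)`.
[cite: CichowlasBrachet2005, eq. (4)] -/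
theorem v_eq (x y z : ℝ) : v x y z = sin y * (cos (3 * z) * cos x - cos z * cos (3 * x)) := rfl

/-- The printed closed form of `w`: `sin z (cos 3x cos y - cos x cos 3y)`.
[cite: CichowlasBrachet2005, eq. (4)] -/
theorem w_eq (x y z : ℝ) : w x y z = sin z * (cos (3 * x) * cos y - cos x * cos (3 * y)) := rfl

/-- Parity: `u` is odd in `x`. [cite: NgBhattacharjee2002, §2 eq. (2)] -/
theorem u_neg_x (x y z : ℝ) : u (-x) y z = -u x y z := by
  unfold u; rw [sin_neg]; ring

/-- Parity: `u` is even in `y`. [cite: NgBhattacharjee2002, §2 eq. (2)] -/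
theorem u_neg_y (x y z : ℝ) : u x (-y) z = u x y z := by
  unfold u; rw [mul_neg, cos_neg, cos_neg]

/-- Parity: `u` is even in `z`. [cite: NgBhattacharjee2002, §2 eq. (2)] -/
theorem u_neg_z (x y z : ℝ) : u x y (-z) = u x y z := by
  unfold u; rw [mul_neg, cos_neg, cos_neg]

/-- `u` vanishes on the plane `x = 0` (and `v`, `w` on `y = 0`, `z = 0` by cyclicity). [folklore] -/
theorem u_zero_x (y z : ℝ) : u 0 y z = 0 := by
  unfold u; rw [sin_zero]; ring

/-- `∂ₓ u = cos x (cos 3y cos z - cos y cos 3z)`. [folklore] -/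
theorem hasDerivAt_u_x (x y z : ℝ) :
    HasDerivAt (fun s => u s y z) (cos x * (cos (3 * y) * cos z - cos y * cos (3 * z))) x := by
  unfold u
  exact (hasDerivAt_sin x).mul_const _

/-- `∂_y v = cos y (cos 3z cos x - cos z cos 3x)`. [folklore] -/
theorem hasDerivAt_v_y (x y z : ℝ) :
    HasDerivAt (fun s => v x s z) (cos y * (cos (3 * z) * cos x - cos z * cos (3 * x))) y := by
  unfold v u
  exact (hasDerivAt_sin y).mul_const _

/-- `∂_z w = cos z (cos 3x cos y - cos x cos 3y)`. [folklore] -/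
theorem hasDerivAt_w_z (x y z : ℝ) :
    HasDerivAt (fun s => w x y s) (cos z * (cos (3 * x) * cos y - cos x * cos (3 * y))) z := by
  unfold w u
  exact (hasDerivAt_sin z).mul_const _

/-- **The Kida–Pelz datum is divergence-free**: `∂ₓu + ∂_y v + ∂_z w = 0` at every point (the six
products cancel in pairs; CB05 state incompressibility as eq. (2)). [folklore] -/
theorem div_eq_zero (x y z : ℝ) :
    deriv (fun s => u s y z) x + deriv (fun s => v x s z) y + deriv (fun s => w x y s) z = 0 := by
  rw [(hasDerivAt_u_x x y z).deriv, (hasDerivAt_v_y x y z).deriv, (hasDerivAt_w_z x y z).deriv]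
  ring

/-- Second derivative of `u` along `x`: `∂ₓ² u = -u`. [folklore] -/
theorem deriv2_u_x (x y z : ℝ) :
    deriv (fun s => deriv (fun r => u r y z) s) x = -u x y z := by
  set c := cos (3 * y) * cos z - cos y * cos (3 * z) with hc
  have h1 : ∀ s, HasDerivAt (fun r => u r y z) (cos s * c) s := fun s => hasDerivAt_u_x s y z
  have hfun : (fun s => deriv (fun r => u r y z) s) = fun s => cos s * c :=
    funext fun s => (h1 s).deriv
  rw [hfun]
  have h2 : HasDerivAt (fun s => cos s * c) (-sin x * c) x := (hasDerivAt_cos x).mul_const c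
  rw [h2.deriv]
  unfold u; ring

/-- Second derivative of `u` along `y`:
`∂_y² u = sin x (-9 cos 3y cos z + cos y cos 3z)`. [folklore] -/
theorem deriv2_u_y (x y z : ℝ) :
    deriv (fun s => deriv (fun r => u x r z) s) y =
      sin x * (-9 * cos (3 * y) * cos z + cos y * cos (3 * z)) := by
  have h1 : ∀ s, HasDerivAt (fun r => u x r z)
      (sin x * (-(3 * sin (3 * s)) * cos z - (-sin s) * cos (3 * z))) s := fun s => by
    unfold u
    exact (((hasDerivAt_cos_const_mul 3 s).mul_const (cos z)).fun_sub
      ((hasDerivAt_cos s).mul_const (cos (3 * z)))).const_mul (sin x)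
  have hfun : (fun s => deriv (fun r => u x r z) s) =
      fun s => sin x * (-(3 * sin (3 * s)) * cos z - (-sin s) * cos (3 * z)) :=
    funext fun s => (h1 s).deriv
  rw [hfun]
  have h2 : HasDerivAt (fun s => sin x * (-(3 * sin (3 * s)) * cos z - (-sin s) * cos (3 * z)))
      (sin x * (-(3 * (3 * cos (3 * y))) * cos z - (-cos y) * cos (3 * z))) y :=
    ((((hasDerivAt_sin_const_mul 3 y).const_mul 3).fun_neg.mul_const (cos z)).fun_sub
      ((hasDerivAt_sin y).fun_neg.mul_const (cos (3 * z)))).const_mul (sin x)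
  rw [h2.deriv]
  ring

/-- Second derivative of `u` along `z`:
`∂_z² u = sin x (-cos 3y cos z + 9 cos y cos 3z)`. [folklore] -/
theorem deriv2_u_z (x y z : ℝ) :
    deriv (fun s => deriv (fun r => u x y r) s) z =
      sin x * (-(cos (3 * y) * cos z) + 9 * cos y * cos (3 * z)) := by
  have h1 : ∀ s, HasDerivAt (fun r => u x y r)
      (sin x * (cos (3 * y) * (-sin s) - cos y * (-(3 * sin (3 * s))))) s := fun s => by
    unfold u
    exact (((hasDerivAt_cos s).const_mul (cos (3 * y))).fun_sub
      ((hasDerivAt_cos_const_mul 3 s).const_mul (cos y))).const_mul (sin x)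
  have hfun : (fun s => deriv (fun r => u x y r) s) =
      fun s => sin x * (cos (3 * y) * (-sin s) - cos y * (-(3 * sin (3 * s)))) :=
    funext fun s => (h1 s).deriv
  rw [hfun]
  have h2 : HasDerivAt (fun s => sin x * (cos (3 * y) * (-sin s) - cos y * (-(3 * sin (3 * s)))))
      (sin x * (cos (3 * y) * (-cos z) - cos y * (-(3 * (3 * cos (3 * z)))))) z :=
    (((hasDerivAt_sin z).fun_neg.const_mul (cos (3 * y))).fun_sub
      (((hasDerivAt_sin_const_mul 3 z).const_mul 3).fun_neg.const_mul (cos y))).const_mul (sin x)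
  rw [h2.deriv]
  ring

/-- **`u` is a Laplace eigenfunction with eigenvalue `-11`**: `∂ₓ²u + ∂_y²u + ∂_z²u = -11u`
(all energy on the shell `|k|² = 1 + 9 + 1 = 11`; the cell's `k₀ = √11` pin and `Z(0) = 11 E(0)`).
[folklore] -/
theorem laplacian_u (x y z : ℝ) :
    deriv (fun s => deriv (fun r => u r y z) s) x + deriv (fun s => deriv (fun r => u x r z) s) y +
      deriv (fun s => deriv (fun r => u x y r) s) z = -11 * u x y z := by
  rw [deriv2_u_x, deriv2_u_y, deriv2_u_z]
  unfold u; ring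

/-- **`v` is a Laplace eigenfunction with eigenvalue `-11`** (cyclic image of `laplacian_u`).
[folklore] -/
theorem laplacian_v (x y z : ℝ) :
    deriv (fun s => deriv (fun r => v r y z) s) x + deriv (fun s => deriv (fun r => v x r z) s) y +
      deriv (fun s => deriv (fun r => v x y r) s) z = -11 * v x y z := by
  have h := laplacian_u y z x
  unfold v
  linarith [h, deriv2_u_x y z x, deriv2_u_y y z x, deriv2_u_z y z x]

/-- **`w` is a Laplace eigenfunction with eigenvalue `-11`** (cyclic image of `laplacian_u`).
[folklore] -/
theorem laplacian_w (x y z : ℝ) :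
    deriv (fun s => deriv (fun r => w r y z) s) x + deriv (fun s => deriv (fun r => w x r z) s) y +
      deriv (fun s => deriv (fun r => w x y r) s) z = -11 * w x y z := by
  have h := laplacian_u z x y
  unfold w
  linarith [h, deriv2_u_x z x y, deriv2_u_y z x y, deriv2_u_z z x y]

end KidaPelz

open intervalIntegral

/-! ## One-variable period integrals (toolkit for the cell averages) -/

namespace PeriodIntegral

/-- `∫₀^{2π} cos(n x) dx = 0` for a nonzero natural number `n`. [folklore] -/
theorem integral_cos_nat_mul (n : ℕ) (hn : n ≠ 0) :
    ∫ x in (0:ℝ)..2 * π, cos (n * x) = 0 := by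
  have hn' : (n : ℝ) ≠ 0 := Nat.cast_ne_zero.mpr hn
  have h := intervalIntegral.integral_comp_mul_left (fun x => cos x) (c := (n : ℝ)) (a := 0)
    (b := 2 * π) hn'
  rw [h, integral_cos]
  have e : sin ((n : ℝ) * (2 * π)) = 0 := by
    have := Real.sin_nat_mul_pi (2 * n)
    rw [← this]; congr 1; push_cast; ring
  simp [e]

/-- `∫₀^{2π} sin(n x) dx = 0` for a nonzero natural number `n`. [folklore] -/
theorem integral_sin_nat_mul (n : ℕ) (hn : n ≠ 0) :
    ∫ x in (0:ℝ)..2 * π, sin (n * x) = 0 := by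
  have hn' : (n : ℝ) ≠ 0 := Nat.cast_ne_zero.mpr hn
  have h := intervalIntegral.integral_comp_mul_left (fun x => sin x) (c := (n : ℝ)) (a := 0)
    (b := 2 * π) hn'
  rw [h, integral_sin]
  have e : cos ((n : ℝ) * (2 * π)) = 1 := by
    have := Real.cos_nat_mul_two_pi n
    rw [← this]
  simp [e]

/-- Linearity over the period for two continuous integrands. [folklore] -/
theorem integral_lin2 (a b : ℝ) (f g : ℝ → ℝ) (hf : Continuous f) (hg : Continuous g) :
    ∫ x in (0:ℝ)..2 * π, (a * f x + b * g x) =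
      a * (∫ x in (0:ℝ)..2 * π, f x) + b * ∫ x in (0:ℝ)..2 * π, g x := by
  rw [intervalIntegral.integral_add, intervalIntegral.integral_const_mul,
    intervalIntegral.integral_const_mul]
  · exact ((continuous_const.mul hf).intervalIntegrable _ _)
  · exact ((continuous_const.mul hg).intervalIntegrable _ _)

/-- Linearity over the period for three continuous integrands. [folklore] -/
theorem integral_lin3 (a b c : ℝ) (f g k : ℝ → ℝ) (hf : Continuous f) (hg : Continuous g)
    (hk : Continuous k) :
    ∫ x in (0:ℝ)..2 * π, (a * f x + b * g x + c * k x) =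
      a * (∫ x in (0:ℝ)..2 * π, f x) + b * (∫ x in (0:ℝ)..2 * π, g x) +
        c * ∫ x in (0:ℝ)..2 * π, k x := by
  rw [intervalIntegral.integral_add, intervalIntegral.integral_const_mul, integral_lin2 a b f g hf hg]
  · exact (((continuous_const.mul hf).add (continuous_const.mul hg)).intervalIntegrable _ _)
  · exact ((continuous_const.mul hk).intervalIntegrable _ _)

/-- Linearity over the period for four continuous integrands. [folklore] -/
theorem integral_lin4 (a b c d : ℝ) (f g k l : ℝ → ℝ) (hf : Continuous f) (hg : Continuous g)
    (hk : Continuous k) (hl : Continuous l) :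
    ∫ x in (0:ℝ)..2 * π, (a * f x + b * g x + c * k x + d * l x) =
      a * (∫ x in (0:ℝ)..2 * π, f x) + b * (∫ x in (0:ℝ)..2 * π, g x) +
        c * (∫ x in (0:ℝ)..2 * π, k x) + d * ∫ x in (0:ℝ)..2 * π, l x := by
  rw [intervalIntegral.integral_add, intervalIntegral.integral_const_mul,
    integral_lin3 a b c f g k hf hg hk]
  · exact ((((continuous_const.mul hf).add (continuous_const.mul hg)).add
      (continuous_const.mul hk)).intervalIntegrable _ _)
  · exact ((continuous_const.mul hl).intervalIntegrable _ _)

/-- Linearity over the period for six continuous integrands. [folklore] -/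
theorem integral_lin6 (a b c d e f₀ : ℝ) (f g k l m n : ℝ → ℝ) (hf : Continuous f)
    (hg : Continuous g) (hk : Continuous k) (hl : Continuous l) (hm : Continuous m)
    (hn : Continuous n) :
    ∫ x in (0:ℝ)..2 * π, (a * f x + b * g x + c * k x + d * l x + e * m x + f₀ * n x) =
      a * (∫ x in (0:ℝ)..2 * π, f x) + b * (∫ x in (0:ℝ)..2 * π, g x) +
        c * (∫ x in (0:ℝ)..2 * π, k x) + d * (∫ x in (0:ℝ)..2 * π, l x) +
          e * (∫ x in (0:ℝ)..2 * π, m x) + f₀ * ∫ x in (0:ℝ)..2 * π, n x := by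
  have h4 := integral_lin4 a b c d f g k l hf hg hk hl
  have h2 := integral_lin2 e f₀ m n hm hn
  have hs : (fun x => a * f x + b * g x + c * k x + d * l x + e * m x + f₀ * n x) =
      fun x => (a * f x + b * g x + c * k x + d * l x) + (e * m x + f₀ * n x) := by
    funext x; ring
  rw [hs, intervalIntegral.integral_add, h4, h2]
  · ring
  · exact (((((continuous_const.mul hf).add (continuous_const.mul hg)).add
      (continuous_const.mul hk)).add (continuous_const.mul hl)).intervalIntegrable _ _)
  · exact (((continuous_const.mul hm).add (continuous_const.mul hn)).intervalIntegrable _ _)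

/-- `∫₀^{2π} 1 dx = 2π`. [folklore] -/
theorem integral_one_two_pi : ∫ _x in (0:ℝ)..2 * π, (1:ℝ) = 2 * π := by
  simp

/-- `∫₀^{2π} sin² x dx = π`. [folklore] -/
theorem integral_sin_sq_two_pi : ∫ x in (0:ℝ)..2 * π, sin x ^ 2 = π := by
  rw [integral_sin_sq]; simp

/-- `∫₀^{2π} cos² x dx = π`. [folklore] -/
theorem integral_cos_sq_two_pi : ∫ x in (0:ℝ)..2 * π, cos x ^ 2 = π := by
  rw [integral_cos_sq]; simp

/-- `∫₀^{2π} cos²(3x) dx = π`. [folklore] -/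
theorem integral_cos_three_sq : ∫ x in (0:ℝ)..2 * π, cos (3 * x) ^ 2 = π := by
  have h : ∀ x : ℝ, cos (3 * x) ^ 2 = (1/2) * 1 + (1/2) * cos ((6:ℕ) * x) := by
    intro x
    have : ((6:ℕ) : ℝ) * x = 3 * x + 3 * x := by push_cast; ring
    rw [this, cos_add]
    nlinarith [sin_sq_add_cos_sq (3 * x)]
  simp_rw [h]
  rw [integral_lin2 _ _ _ _ continuous_const (by fun_prop), integral_one_two_pi,
    integral_cos_nat_mul 6 (by norm_num)]
  ring

/-- `∫₀^{2π} sin²(3x) dx = π`. [folklore] -/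
theorem integral_sin_three_sq : ∫ x in (0:ℝ)..2 * π, sin (3 * x) ^ 2 = π := by
  have h : ∀ x : ℝ, sin (3 * x) ^ 2 = (1/2) * 1 + (-1/2) * cos ((6:ℕ) * x) := by
    intro x
    have : ((6:ℕ) : ℝ) * x = 3 * x + 3 * x := by push_cast; ring
    rw [this, cos_add]
    nlinarith [sin_sq_add_cos_sq (3 * x)]
  simp_rw [h]
  rw [integral_lin2 _ _ _ _ continuous_const (by fun_prop), integral_one_two_pi,
    integral_cos_nat_mul 6 (by norm_num)]
  ring

/-- `∫₀^{2π} cos x cos 3x dx = 0` (orthogonality of distinct Fourier modes). [folklore] -/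
theorem integral_cos_mul_cos_three : ∫ x in (0:ℝ)..2 * π, cos x * cos (3 * x) = 0 := by
  have h : ∀ x : ℝ, cos x * cos (3 * x) = (1/2) * cos ((4:ℕ) * x) + (1/2) * cos ((2:ℕ) * x) := by
    intro x
    have e4 : ((4:ℕ) : ℝ) * x = 3 * x + x := by push_cast; ring
    have e2 : ((2:ℕ) : ℝ) * x = 3 * x - x := by push_cast; ring
    rw [e4, e2, cos_add, cos_sub]; ring
  simp_rw [h]
  rw [integral_lin2 _ _ _ _ (by fun_prop) (by fun_prop), integral_cos_nat_mul 4 (by norm_num),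
    integral_cos_nat_mul 2 (by norm_num)]
  ring

/-- `∫₀^{2π} sin x sin 3x dx = 0`. [folklore] -/
theorem integral_sin_mul_sin_three : ∫ x in (0:ℝ)..2 * π, sin x * sin (3 * x) = 0 := by
  have h : ∀ x : ℝ, sin x * sin (3 * x) = (1/2) * cos ((2:ℕ) * x) + (-1/2) * cos ((4:ℕ) * x) := by
    intro x
    have e4 : ((4:ℕ) : ℝ) * x = 3 * x + x := by push_cast; ring
    have e2 : ((2:ℕ) : ℝ) * x = 3 * x - x := by push_cast; ring
    rw [e4, e2, cos_add, cos_sub]; ring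
  simp_rw [h]
  rw [integral_lin2 _ _ _ _ (by fun_prop) (by fun_prop), integral_cos_nat_mul 4 (by norm_num),
    integral_cos_nat_mul 2 (by norm_num)]
  ring

/-- `∫₀^{2π} sin x cos x dx = 0`. [folklore] -/
theorem integral_sin_mul_cos : ∫ x in (0:ℝ)..2 * π, sin x * cos x = 0 := by
  have h : ∀ x : ℝ, sin x * cos x = (1/2) * sin ((2:ℕ) * x) + 0 * (1:ℝ) := by
    intro x
    have e2 : ((2:ℕ) : ℝ) * x = x + x := by push_cast; ring
    rw [e2, sin_add]; ring
  simp_rw [h]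
  rw [integral_lin2 _ _ _ _ (by fun_prop) continuous_const, integral_sin_nat_mul 2 (by norm_num)]
  ring

/-- `∫₀^{2π} cos x sin 3x dx = 0`. [folklore] -/
theorem integral_cos_mul_sin_three : ∫ x in (0:ℝ)..2 * π, cos x * sin (3 * x) = 0 := by
  have h : ∀ x : ℝ, cos x * sin (3 * x) = (1/2) * sin ((4:ℕ) * x) + (1/2) * sin ((2:ℕ) * x) := by
    intro x
    have e4 : ((4:ℕ) : ℝ) * x = 3 * x + x := by push_cast; ring
    have e2 : ((2:ℕ) : ℝ) * x = 3 * x - x := by push_cast; ring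
    rw [e4, e2, sin_add, sin_sub]; ring
  simp_rw [h]
  rw [integral_lin2 _ _ _ _ (by fun_prop) (by fun_prop), integral_sin_nat_mul 4 (by norm_num),
    integral_sin_nat_mul 2 (by norm_num)]
  ring

/-- `∫₀^{2π} sin x cos 3x dx = 0`. [folklore] -/
theorem integral_sin_mul_cos_three : ∫ x in (0:ℝ)..2 * π, sin x * cos (3 * x) = 0 := by
  have h : ∀ x : ℝ, sin x * cos (3 * x) = (1/2) * sin ((4:ℕ) * x) + (-1/2) * sin ((2:ℕ) * x) := by
    intro x
    have e4 : ((4:ℕ) : ℝ) * x = 3 * x + x := by push_cast; ring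
    have e2 : ((2:ℕ) : ℝ) * x = 3 * x - x := by push_cast; ring
    rw [e4, e2, sin_add, sin_sub]; ring
  simp_rw [h]
  rw [integral_lin2 _ _ _ _ (by fun_prop) (by fun_prop), integral_sin_nat_mul 4 (by norm_num),
    integral_sin_nat_mul 2 (by norm_num)]
  ring

/-- `∫₀^{2π} sin 3x cos 3x dx = 0`. [folklore] -/
theorem integral_sin_three_mul_cos_three :
    ∫ x in (0:ℝ)..2 * π, sin (3 * x) * cos (3 * x) = 0 := by
  have h : ∀ x : ℝ, sin (3 * x) * cos (3 * x) = (1/2) * sin ((6:ℕ) * x) + 0 * (1:ℝ) := by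
    intro x
    have e6 : ((6:ℕ) : ℝ) * x = 3 * x + 3 * x := by push_cast; ring
    rw [e6, sin_add]; ring
  simp_rw [h]
  rw [integral_lin2 _ _ _ _ (by fun_prop) continuous_const, integral_sin_nat_mul 6 (by norm_num)]
  ring

end PeriodIntegral

/-! ## Cell averages over the period box `[0,2π]³`

The averages are written as ITERATED interval integrals (`x` outermost, `z` innermost); for the
trigonometric polynomials of this file every inner integral is computed in closed form before the
next one is taken, so no Fubini/measurability bookkeeping is needed. Normalisation as in the
cell's solvers and in [cite: VanReesEtAl2011VortexSpectral, §3.1] / [cite: CichowlasBrachet2005,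
eq. (6)]: `E = ½⟨|u|²⟩`, `Z = ½⟨|ω|²⟩`, `⟨·⟩` = volume average over the `(2π)³` cell. -/

/-- Iterated integral of `f` over the period cell `[0,2π]³` (`x` outermost, `z` innermost). [folklore] -/
def cellIntegral (f : ℝ → ℝ → ℝ → ℝ) : ℝ :=
  ∫ x in (0:ℝ)..2 * π, ∫ y in (0:ℝ)..2 * π, ∫ z in (0:ℝ)..2 * π, f x y z

/-- Volume average `⟨f⟩ = (2π)⁻³ ∫∫∫ f` over the period cell. [folklore] -/
def cellMean (f : ℝ → ℝ → ℝ → ℝ) : ℝ := cellIntegral f / (2 * π) ^ 3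

/-- First vorticity component `ω₁ = ∂_y w - ∂_z v` of a velocity field `(u,v,w)` given by
components, derivatives along coordinate lines. [folklore] -/
def vorticity₁ (_u v w : ℝ → ℝ → ℝ → ℝ) (x y z : ℝ) : ℝ :=
  deriv (fun s => w x s z) y - deriv (fun s => v x y s) z

/-- Second vorticity component `ω₂ = ∂_z u - ∂ₓ w`. [folklore] -/
def vorticity₂ (u _v w : ℝ → ℝ → ℝ → ℝ) (x y z : ℝ) : ℝ :=
  deriv (fun s => u x y s) z - deriv (fun s => w s y z) x

/-- Third vorticity component `ω₃ = ∂ₓ v - ∂_y u`. [folklore] -/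
def vorticity₃ (u v _w : ℝ → ℝ → ℝ → ℝ) (x y z : ℝ) : ℝ :=
  deriv (fun s => v s y z) x - deriv (fun s => u x s z) y

/-- Mean kinetic energy `E = ½⟨u² + v² + w²⟩` of the datum `(u,v,w)`. [folklore] -/
def cellEnergy (u v w : ℝ → ℝ → ℝ → ℝ) : ℝ :=
  cellMean (fun x y z => u x y z ^ 2 + v x y z ^ 2 + w x y z ^ 2) / 2

/-- Enstrophy `Z = ½⟨|ω|²⟩` of the datum `(u,v,w)` (= `cellEnergy` of its vorticity). [folklore] -/
def cellEnstrophy (u v w : ℝ → ℝ → ℝ → ℝ) : ℝ :=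
  cellEnergy (vorticity₁ u v w) (vorticity₂ u v w) (vorticity₃ u v w)

/-- Mean helicity `H = ⟨u·ω⟩` of the datum `(u,v,w)`. [folklore] -/
def cellHelicity (u v w : ℝ → ℝ → ℝ → ℝ) : ℝ :=
  cellMean (fun x y z => u x y z * vorticity₁ u v w x y z + v x y z * vorticity₂ u v w x y z +
    w x y z * vorticity₃ u v w x y z)

/-- `⟨f⟩ = ∫∫∫ f / (8π³)`. [folklore] -/
theorem cellMean_eq (f : ℝ → ℝ → ℝ → ℝ) : cellMean f = cellIntegral f / (8 * π ^ 3) := by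
  unfold cellMean; ring

/-! ## Taylor–Green: vorticity, energy `1/8`, enstrophy `3/8`, helicity `0` -/

namespace TaylorGreen

open PeriodIntegral

/-- `∂_y u = -sin x sin y cos z`. [folklore] -/
theorem hasDerivAt_u_y (x y z : ℝ) :
    HasDerivAt (fun s => u x s z) (-(sin x * sin y * cos z)) y := by
  unfold u
  have h := ((hasDerivAt_cos y).const_mul (sin x)).mul_const (cos z)
  exact h.congr_deriv (by ring)

/-- `∂_z u = -sin x cos y sin z`. [folklore] -/
theorem hasDerivAt_u_z (x y z : ℝ) :
    HasDerivAt (fun s => u x y s) (-(sin x * cos y * sin z)) z := by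
  unfold u
  have h := (hasDerivAt_cos z).const_mul (sin x * cos y)
  exact h.congr_deriv (by ring)

/-- `∂ₓ v = sin x sin y cos z`. [folklore] -/
theorem hasDerivAt_v_x (x y z : ℝ) :
    HasDerivAt (fun s => v s y z) (sin x * sin y * cos z) x := by
  unfold v
  have h := (((hasDerivAt_cos x).mul_const (sin y)).mul_const (cos z)).fun_neg
  exact h.congr_deriv (by ring)

/-- `∂_z v = cos x sin y sin z`. [folklore] -/
theorem hasDerivAt_v_z (x y z : ℝ) :
    HasDerivAt (fun s => v x y s) (cos x * sin y * sin z) z := by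
  unfold v
  have h := ((hasDerivAt_cos z).const_mul (cos x * sin y)).fun_neg
  exact h.congr_deriv (by ring)

/-- **Vorticity of the Taylor–Green datum**, first component: `ω₁ = -cos x sin y sin z`. [folklore] -/
theorem vorticity₁_eq (x y z : ℝ) : vorticity₁ u v w x y z = -(cos x * sin y * sin z) := by
  unfold vorticity₁
  rw [show (fun s => w x s z) = fun _ => (0:ℝ) from rfl, deriv_const, (hasDerivAt_v_z x y z).deriv]
  ring

/-- Second component: `ω₂ = -sin x cos y sin z`. [folklore] -/
theorem vorticity₂_eq (x y z : ℝ) : vorticity₂ u v w x y z = -(sin x * cos y * sin z) := by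
  unfold vorticity₂
  rw [show (fun s => w s y z) = fun _ => (0:ℝ) from rfl, deriv_const, (hasDerivAt_u_z x y z).deriv]
  ring

/-- Third component: `ω₃ = 2 sin x sin y cos z`. [folklore] -/
theorem vorticity₃_eq (x y z : ℝ) : vorticity₃ u v w x y z = 2 * (sin x * sin y * cos z) := by
  unfold vorticity₃
  rw [(hasDerivAt_v_x x y z).deriv, (hasDerivAt_u_y x y z).deriv]
  ring

/-- Innermost (`z`) integral of `|u|²`. [folklore] -/
theorem integral_z_speed_sq (x y : ℝ) :
    ∫ z in (0:ℝ)..2 * π, (u x y z ^ 2 + v x y z ^ 2 + w x y z ^ 2) =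
      π * (sin x ^ 2 * cos y ^ 2 + cos x ^ 2 * sin y ^ 2) := by
  have h : (fun z => u x y z ^ 2 + v x y z ^ 2 + w x y z ^ 2) =
      fun z => (sin x ^ 2 * cos y ^ 2 + cos x ^ 2 * sin y ^ 2) * cos z ^ 2 := by
    funext z; unfold u v w; ring
  rw [h, intervalIntegral.integral_const_mul, integral_cos_sq_two_pi]; ring

/-- The `y,z` integral of `|u|²` is `π²`, independently of `x`. [folklore] -/
theorem integral_yz_speed_sq (x : ℝ) :
    ∫ y in (0:ℝ)..2 * π, ∫ z in (0:ℝ)..2 * π, (u x y z ^ 2 + v x y z ^ 2 + w x y z ^ 2) = π ^ 2 := by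
  have h : (fun y => ∫ z in (0:ℝ)..2 * π, (u x y z ^ 2 + v x y z ^ 2 + w x y z ^ 2)) =
      fun y => (π * sin x ^ 2) * cos y ^ 2 + (π * cos x ^ 2) * sin y ^ 2 := by
    funext y; rw [integral_z_speed_sq]; ring
  rw [h, integral_lin2 _ _ _ _ (by fun_prop) (by fun_prop), integral_cos_sq_two_pi,
    integral_sin_sq_two_pi]
  nlinarith [sin_sq_add_cos_sq x]

/-- `∫∫∫ |u|² = 2π³` for the Taylor–Green datum. [folklore] -/
theorem cellIntegral_speed_sq :
    cellIntegral (fun x y z => u x y z ^ 2 + v x y z ^ 2 + w x y z ^ 2) = 2 * π ^ 3 := by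
  unfold cellIntegral
  have h : (fun x => ∫ y in (0:ℝ)..2 * π, ∫ z in (0:ℝ)..2 * π,
      (u x y z ^ 2 + v x y z ^ 2 + w x y z ^ 2)) = fun _ => π ^ 2 :=
    funext fun x => integral_yz_speed_sq x
  rw [h, intervalIntegral.integral_const]
  simp; ring

/-- **`E(0) = 1/8` for the Taylor–Green datum** (`½⟨|u|²⟩` for the `θ = 0` datum of
[cite: VanReesEtAl2011VortexSpectral, eq. (10)]; the cell's gate G1-a `t = 0` sanity line
`E(0) = 0.125`). [folklore] -/
theorem cellEnergy_eq : cellEnergy u v w = 1 / 8 := by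
  unfold cellEnergy
  rw [cellMean_eq, cellIntegral_speed_sq]
  rw [div_div, div_eq_iff (by positivity)]
  ring

/-- Innermost (`z`) integral of `|ω|²`. [folklore] -/
theorem integral_z_vorticity_sq (x y : ℝ) :
    ∫ z in (0:ℝ)..2 * π, (vorticity₁ u v w x y z ^ 2 + vorticity₂ u v w x y z ^ 2 +
      vorticity₃ u v w x y z ^ 2) =
      π * (cos x ^ 2 * sin y ^ 2 + sin x ^ 2 * cos y ^ 2) + π * (4 * (sin x ^ 2 * sin y ^ 2)) := by
  have h : (fun z => vorticity₁ u v w x y z ^ 2 + vorticity₂ u v w x y z ^ 2 +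
      vorticity₃ u v w x y z ^ 2) = fun z => (cos x ^ 2 * sin y ^ 2 + sin x ^ 2 * cos y ^ 2) *
        sin z ^ 2 + (4 * (sin x ^ 2 * sin y ^ 2)) * cos z ^ 2 := by
    funext z; rw [vorticity₁_eq, vorticity₂_eq, vorticity₃_eq]; ring
  rw [h, integral_lin2 _ _ _ _ (by fun_prop) (by fun_prop), integral_sin_sq_two_pi,
    integral_cos_sq_two_pi]
  ring

/-- The `y,z` integral of `|ω|²` is `π² + 4π² sin² x`. [folklore] -/
theorem integral_yz_vorticity_sq (x : ℝ) :
    ∫ y in (0:ℝ)..2 * π, ∫ z in (0:ℝ)..2 * π, (vorticity₁ u v w x y z ^ 2 +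
      vorticity₂ u v w x y z ^ 2 + vorticity₃ u v w x y z ^ 2) = π ^ 2 + 4 * π ^ 2 * sin x ^ 2 := by
  have h : (fun y => ∫ z in (0:ℝ)..2 * π, (vorticity₁ u v w x y z ^ 2 +
      vorticity₂ u v w x y z ^ 2 + vorticity₃ u v w x y z ^ 2)) =
      fun y => (π * cos x ^ 2 + 4 * π * sin x ^ 2) * sin y ^ 2 + (π * sin x ^ 2) * cos y ^ 2 := by
    funext y; rw [integral_z_vorticity_sq]; ring
  rw [h, integral_lin2 _ _ _ _ (by fun_prop) (by fun_prop), integral_cos_sq_two_pi,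
    integral_sin_sq_two_pi]
  nlinarith [sin_sq_add_cos_sq x]

/-- `∫∫∫ |ω|² = 6π³` for the Taylor–Green datum. [folklore] -/
theorem cellIntegral_vorticity_sq :
    cellIntegral (fun x y z => vorticity₁ u v w x y z ^ 2 + vorticity₂ u v w x y z ^ 2 +
      vorticity₃ u v w x y z ^ 2) = 6 * π ^ 3 := by
  unfold cellIntegral
  have h : (fun x => ∫ y in (0:ℝ)..2 * π, ∫ z in (0:ℝ)..2 * π, (vorticity₁ u v w x y z ^ 2 +
      vorticity₂ u v w x y z ^ 2 + vorticity₃ u v w x y z ^ 2)) =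
      fun x => π ^ 2 * 1 + (4 * π ^ 2) * sin x ^ 2 := by
    funext x; rw [integral_yz_vorticity_sq]; ring
  rw [h, integral_lin2 _ _ _ _ continuous_const (by fun_prop), integral_one_two_pi, integral_sin_sq_two_pi]
  ring

/-- **`Z(0) = 3/8` for the Taylor–Green datum** (`½⟨|ω|²⟩ = 3·E(0)`, all energy on `|k|² = 3`;
the cell's gate G1-a sanity line `Z(0) = 0.375`, `ε(0) = 2νZ(0)`). [folklore] -/
theorem cellEnstrophy_eq : cellEnstrophy u v w = 3 / 8 := by
  unfold cellEnstrophy cellEnergy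
  rw [cellMean_eq, cellIntegral_vorticity_sq, div_div, div_eq_iff (by positivity)]
  ring

/-- `Z(0) = 3 E(0)` for the Taylor–Green datum. [folklore] -/
theorem cellEnstrophy_eq_three_mul_cellEnergy : cellEnstrophy u v w = 3 * cellEnergy u v w := by
  rw [cellEnstrophy_eq, cellEnergy_eq]; norm_num

/-- The helicity density `u·ω` of the Taylor–Green datum vanishes POINTWISE. [folklore] -/
theorem helicityDensity_eq_zero (x y z : ℝ) :
    u x y z * vorticity₁ u v w x y z + v x y z * vorticity₂ u v w x y z +
      w x y z * vorticity₃ u v w x y z = 0 := by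
  rw [vorticity₁_eq, vorticity₂_eq, vorticity₃_eq]; unfold u v w; ring

/-- **`H(0) = 0` for the Taylor–Green datum** (mean helicity). [folklore] -/
theorem cellHelicity_eq : cellHelicity u v w = 0 := by
  unfold cellHelicity cellMean cellIntegral
  simp_rw [helicityDensity_eq_zero]
  simp

/-! ### The Taylor–Green initial pressure (DeBonis eq. (10)) solves the pressure-Poisson equation -/

/-- The Taylor–Green initial pressure `p = (cos 2x + cos 2y)(cos 2z + 2)/16` (with `p₀ = 0`,
`ρ₀ = V₀ = L = 1`). [cite: DeBonis2013TaylorGreen, eq. (10)] -/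
def p (x y z : ℝ) : ℝ := (cos (2 * x) + cos (2 * y)) * (cos (2 * z) + 2) / 16

/-- `∂ₓ² p = -4 cos 2x (cos 2z + 2)/16`. [folklore] -/
theorem deriv2_p_x (x y z : ℝ) :
    deriv (fun s => deriv (fun r => p r y z) s) x = -(4 * cos (2 * x)) * (cos (2 * z) + 2) / 16 := by
  have h1 : ∀ s, HasDerivAt (fun r => p r y z) (-(2 * sin (2 * s)) * (cos (2 * z) + 2) / 16) s :=
    fun s => by
    unfold p
    exact (((hasDerivAt_cos_const_mul 2 s).add_const (cos (2 * y))).mul_const _).div_const 16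
  have hfun : (fun s => deriv (fun r => p r y z) s) =
      fun s => -(2 * sin (2 * s)) * (cos (2 * z) + 2) / 16 := funext fun s => (h1 s).deriv
  rw [hfun]
  have h2 : HasDerivAt (fun s => -(2 * sin (2 * s)) * (cos (2 * z) + 2) / 16)
      (-(2 * (2 * cos (2 * x))) * (cos (2 * z) + 2) / 16) x :=
    ((((hasDerivAt_sin_const_mul 2 x).const_mul 2).fun_neg).mul_const _).div_const 16
  rw [h2.deriv]; ring

/-- `∂_y² p = -4 cos 2y (cos 2z + 2)/16`. [folklore] -/
theorem deriv2_p_y (x y z : ℝ) :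
    deriv (fun s => deriv (fun r => p x r z) s) y = -(4 * cos (2 * y)) * (cos (2 * z) + 2) / 16 := by
  have h1 : ∀ s, HasDerivAt (fun r => p x r z) (-(2 * sin (2 * s)) * (cos (2 * z) + 2) / 16) s :=
    fun s => by
    unfold p
    exact (((hasDerivAt_cos_const_mul 2 s).const_add (cos (2 * x))).mul_const _).div_const 16
  have hfun : (fun s => deriv (fun r => p x r z) s) =
      fun s => -(2 * sin (2 * s)) * (cos (2 * z) + 2) / 16 := funext fun s => (h1 s).deriv
  rw [hfun]
  have h2 : HasDerivAt (fun s => -(2 * sin (2 * s)) * (cos (2 * z) + 2) / 16)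
      (-(2 * (2 * cos (2 * y))) * (cos (2 * z) + 2) / 16) y :=
    ((((hasDerivAt_sin_const_mul 2 y).const_mul 2).fun_neg).mul_const _).div_const 16
  rw [h2.deriv]; ring

/-- `∂_z² p = -4 (cos 2x + cos 2y) cos 2z /16`. [folklore] -/
theorem deriv2_p_z (x y z : ℝ) :
    deriv (fun s => deriv (fun r => p x y r) s) z =
      (cos (2 * x) + cos (2 * y)) * (-(4 * cos (2 * z))) / 16 := by
  have h1 : ∀ s, HasDerivAt (fun r => p x y r)
      ((cos (2 * x) + cos (2 * y)) * (-(2 * sin (2 * s))) / 16) s := fun s => by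
    unfold p
    exact (((hasDerivAt_cos_const_mul 2 s).add_const (2:ℝ)).const_mul _).div_const 16
  have hfun : (fun s => deriv (fun r => p x y r) s) =
      fun s => (cos (2 * x) + cos (2 * y)) * (-(2 * sin (2 * s))) / 16 :=
    funext fun s => (h1 s).deriv
  rw [hfun]
  have h2 : HasDerivAt (fun s => (cos (2 * x) + cos (2 * y)) * (-(2 * sin (2 * s))) / 16)
      ((cos (2 * x) + cos (2 * y)) * (-(2 * (2 * cos (2 * z)))) / 16) z :=
    ((((hasDerivAt_sin_const_mul 2 z).const_mul 2).fun_neg).const_mul _).div_const 16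
  rw [h2.deriv]; ring

/-- `Δp = -(cos 2x + cos 2y)(cos 2z + 1)/2` for the Taylor–Green initial pressure. [folklore] -/
theorem laplacian_p (x y z : ℝ) :
    deriv (fun s => deriv (fun r => p r y z) s) x + deriv (fun s => deriv (fun r => p x r z) s) y +
      deriv (fun s => deriv (fun r => p x y r) s) z =
      -((cos (2 * x) + cos (2 * y)) * (cos (2 * z) + 1)) / 2 := by
  rw [deriv2_p_x, deriv2_p_y, deriv2_p_z]; ring

/-- The contraction `∂ᵢuⱼ ∂ⱼuᵢ` of the Taylor–Green velocity gradient with its transpose equals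
`(cos 2x + cos 2y)(cos 2z + 1)/2`. [folklore] -/
theorem velocityGradient_contraction (x y z : ℝ) :
    deriv (fun s => u s y z) x ^ 2 + deriv (fun s => v x s z) y ^ 2 + deriv (fun s => w x y s) z ^ 2 +
      2 * (deriv (fun s => v s y z) x * deriv (fun s => u x s z) y) +
      2 * (deriv (fun s => w s y z) x * deriv (fun s => u x y s) z) +
      2 * (deriv (fun s => w x s z) y * deriv (fun s => v x y s) z) =
      (cos (2 * x) + cos (2 * y)) * (cos (2 * z) + 1) / 2 := by
  rw [(hasDerivAt_u_x x y z).deriv, (hasDerivAt_v_y x y z).deriv, (hasDerivAt_w_z x y z).deriv,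
    (hasDerivAt_v_x x y z).deriv, (hasDerivAt_u_y x y z).deriv, (hasDerivAt_u_z x y z).deriv,
    (hasDerivAt_v_z x y z).deriv, show (fun s => w s y z) = fun _ => (0:ℝ) from rfl,
    show (fun s => w x s z) = fun _ => (0:ℝ) from rfl, deriv_const, deriv_const]
  rw [cos_two_mul, cos_two_mul, cos_two_mul]
  linear_combination (-2 * cos z ^ 2 * sin y ^ 2) * sin_sq_add_cos_sq x +
    (2 * cos z ^ 2 * (cos x ^ 2 - 1)) * sin_sq_add_cos_sq y

/-- **Pressure-Poisson consistency of the Taylor–Green initial state**: DeBonis's initial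
pressure satisfies `Δp = -∂ᵢuⱼ ∂ⱼuᵢ` at every point, i.e. `(u, p)` is an admissible
incompressible initial state (the divergence of `∂ₜu = -(u·∇)u - ∇p + νΔu` vanishes at `t = 0`).
[cite: DeBonis2013TaylorGreen, eq. (10)] -/
theorem pressurePoisson (x y z : ℝ) :
    deriv (fun s => deriv (fun r => p r y z) s) x + deriv (fun s => deriv (fun r => p x r z) s) y +
      deriv (fun s => deriv (fun r => p x y r) s) z =
      -(deriv (fun s => u s y z) x ^ 2 + deriv (fun s => v x s z) y ^ 2 +
          deriv (fun s => w x y s) z ^ 2 +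
        2 * (deriv (fun s => v s y z) x * deriv (fun s => u x s z) y) +
        2 * (deriv (fun s => w s y z) x * deriv (fun s => u x y s) z) +
        2 * (deriv (fun s => w x s z) y * deriv (fun s => v x y s) z)) := by
  rw [velocityGradient_contraction, laplacian_p]; ring

end TaylorGreen


/-! ## Kida–Pelz: vorticity, energy `3/8`, enstrophy `33/8`, helicity `0` -/

namespace KidaPelz

open PeriodIntegral

/-- `∂_y u = sin x (-3 sin 3y cos z + sin y cos 3z)`. [folklore] -/
theorem hasDerivAt_u_y (x y z : ℝ) :
    HasDerivAt (fun s => u x s z) (sin x * (-3 * sin (3 * y) * cos z + sin y * cos (3 * z))) y := by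
  unfold u
  have h := (((hasDerivAt_cos_const_mul 3 y).mul_const (cos z)).fun_sub
    ((hasDerivAt_cos y).mul_const (cos (3 * z)))).const_mul (sin x)
  exact h.congr_deriv (by ring)

/-- `∂_z u = sin x (-cos 3y sin z + 3 cos y sin 3z)`. [folklore] -/
theorem hasDerivAt_u_z (x y z : ℝ) :
    HasDerivAt (fun s => u x y s) (sin x * (-(cos (3 * y) * sin z) + 3 * cos y * sin (3 * z))) z := by
  unfold u
  have h := (((hasDerivAt_cos z).const_mul (cos (3 * y))).fun_sub
    ((hasDerivAt_cos_const_mul 3 z).const_mul (cos y))).const_mul (sin x)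
  exact h.congr_deriv (by ring)

/-- **Vorticity of the Kida–Pelz datum**, first component:
`ω₁ = -2 cos 3x sin y sin z + 3 cos x (sin 3y sin z + sin y sin 3z)`. [folklore] -/
theorem vorticity₁_eq (x y z : ℝ) : vorticity₁ u v w x y z =
    -2 * cos (3 * x) * sin y * sin z + 3 * cos x * (sin (3 * y) * sin z + sin y * sin (3 * z)) := by
  unfold vorticity₁ v w
  rw [(hasDerivAt_u_z z x y).deriv, (hasDerivAt_u_y y z x).deriv]
  ring

/-- Second component: `ω₂ = -2 sin x cos 3y sin z + 3 cos y (sin x sin 3z + sin 3x sin z)`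
(the cyclic image `ω₂(x,y,z) = ω₁(y,z,x)`). [folklore] -/
theorem vorticity₂_eq (x y z : ℝ) : vorticity₂ u v w x y z =
    -2 * sin x * cos (3 * y) * sin z + 3 * cos y * (sin x * sin (3 * z) + sin (3 * x) * sin z) := by
  unfold vorticity₂ w
  rw [(hasDerivAt_u_z x y z).deriv, (hasDerivAt_u_y z x y).deriv]
  ring

/-- Third component: `ω₃ = -2 sin x sin y cos 3z + 3 cos z (sin 3x sin y + sin x sin 3y)`
(the cyclic image `ω₃(x,y,z) = ω₁(z,x,y)`). [folklore] -/
theorem vorticity₃_eq (x y z : ℝ) : vorticity₃ u v w x y z =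
    -2 * sin x * sin y * cos (3 * z) + 3 * cos z * (sin (3 * x) * sin y + sin x * sin (3 * y)) := by
  unfold vorticity₃ v
  rw [(hasDerivAt_u_z y z x).deriv, (hasDerivAt_u_y x y z).deriv]
  ring

/-- The cyclic symmetry of the datum passes to the vorticity: `ω₂(x,y,z) = ω₁(y,z,x)`. [folklore] -/
theorem vorticity₂_eq_vorticity₁ (x y z : ℝ) : vorticity₂ u v w x y z = vorticity₁ u v w y z x := by
  rw [vorticity₂_eq, vorticity₁_eq]; ring

/-- `ω₃(x,y,z) = ω₁(z,x,y)`. [folklore] -/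
theorem vorticity₃_eq_vorticity₁ (x y z : ℝ) : vorticity₃ u v w x y z = vorticity₁ u v w z x y := by
  rw [vorticity₃_eq, vorticity₁_eq]; ring

/-- Innermost (`z`) integral of `|u|²`. [folklore] -/
theorem integral_z_speed_sq (x y : ℝ) :
    ∫ z in (0:ℝ)..2 * π, (u x y z ^ 2 + v x y z ^ 2 + w x y z ^ 2) =
      π * (sin x ^ 2 * cos (3 * y) ^ 2 + sin y ^ 2 * cos (3 * x) ^ 2) +
        π * (sin x ^ 2 * cos y ^ 2 + sin y ^ 2 * cos x ^ 2) +
          π * (cos (3 * x) * cos y - cos x * cos (3 * y)) ^ 2 := by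
  have h : (fun z => u x y z ^ 2 + v x y z ^ 2 + w x y z ^ 2) = fun z =>
      (sin x ^ 2 * cos (3 * y) ^ 2 + sin y ^ 2 * cos (3 * x) ^ 2) * cos z ^ 2 +
      (sin x ^ 2 * cos y ^ 2 + sin y ^ 2 * cos x ^ 2) * cos (3 * z) ^ 2 +
      (-2 * (sin x ^ 2 * cos (3 * y) * cos y + sin y ^ 2 * cos x * cos (3 * x))) *
        (cos z * cos (3 * z)) +
      (cos (3 * x) * cos y - cos x * cos (3 * y)) ^ 2 * sin z ^ 2 := by
    funext z; unfold v w u; ring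
  rw [h, integral_lin4 _ _ _ _ _ _ _ _ (by fun_prop) (by fun_prop) (by fun_prop) (by fun_prop),
    integral_cos_sq_two_pi, integral_cos_three_sq, integral_cos_mul_cos_three,
    integral_sin_sq_two_pi]
  ring

/-- The `y,z` integral of `|u|²` is `π² (2 + 2 cos² 3x)`. [folklore] -/
theorem integral_yz_speed_sq (x : ℝ) :
    ∫ y in (0:ℝ)..2 * π, ∫ z in (0:ℝ)..2 * π, (u x y z ^ 2 + v x y z ^ 2 + w x y z ^ 2) =
      π ^ 2 * (2 + 2 * cos (3 * x) ^ 2) := by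
  have h : (fun y => ∫ z in (0:ℝ)..2 * π, (u x y z ^ 2 + v x y z ^ 2 + w x y z ^ 2)) = fun y =>
      (π * (sin x ^ 2 + cos x ^ 2)) * cos (3 * y) ^ 2 + (π * (cos (3 * x) ^ 2 + cos x ^ 2)) *
        sin y ^ 2 + (π * (sin x ^ 2 + cos (3 * x) ^ 2)) * cos y ^ 2 +
        (-2 * π * cos (3 * x) * cos x) * (cos y * cos (3 * y)) := by
    funext y; rw [integral_z_speed_sq]; ring
  rw [h, integral_lin4 _ _ _ _ _ _ _ _ (by fun_prop) (by fun_prop) (by fun_prop) (by fun_prop),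
    integral_cos_three_sq, integral_sin_sq_two_pi, integral_cos_sq_two_pi,
    integral_cos_mul_cos_three]
  linear_combination (2 * π ^ 2) * sin_sq_add_cos_sq x

/-- `∫∫∫ |u|² = 6π³` for the Kida–Pelz datum. [folklore] -/
theorem cellIntegral_speed_sq :
    cellIntegral (fun x y z => u x y z ^ 2 + v x y z ^ 2 + w x y z ^ 2) = 6 * π ^ 3 := by
  unfold cellIntegral
  have h : (fun x => ∫ y in (0:ℝ)..2 * π, ∫ z in (0:ℝ)..2 * π,
      (u x y z ^ 2 + v x y z ^ 2 + w x y z ^ 2)) =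
      fun x => (2 * π ^ 2) * 1 + (2 * π ^ 2) * cos (3 * x) ^ 2 := by
    funext x; rw [integral_yz_speed_sq]; ring
  rw [h, integral_lin2 _ _ _ _ continuous_const (by fun_prop), integral_one_two_pi,
    integral_cos_three_sq]
  ring

/-- **`E(0) = 3/8` for the Kida–Pelz datum** (`½⟨|u|²⟩`, each component contributing `¼`;
the value the cell's GRID validated the native `kida_pelz` initial condition against,
`E(0) = 0.3749999` in single precision). [folklore] -/
theorem cellEnergy_eq : cellEnergy u v w = 3 / 8 := by
  unfold cellEnergy
  rw [cellMean_eq, cellIntegral_speed_sq, div_div, div_eq_iff (by positivity)]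
  ring

/-- Innermost (`z`) integral of `|ω|²`. [folklore] -/
theorem integral_z_vorticity_sq (x y : ℝ) :
    ∫ z in (0:ℝ)..2 * π, (vorticity₁ u v w x y z ^ 2 + vorticity₂ u v w x y z ^ 2 +
      vorticity₃ u v w x y z ^ 2) =
      π * (4 * cos (3 * x) ^ 2 * sin y ^ 2 + 9 * cos x ^ 2 * sin (3 * y) ^ 2 -
          12 * cos (3 * x) * cos x * sin y * sin (3 * y) + 4 * sin x ^ 2 * cos (3 * y) ^ 2 -
          12 * sin x * sin (3 * x) * cos (3 * y) * cos y + 9 * cos y ^ 2 * sin (3 * x) ^ 2) +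
        π * (9 * cos x ^ 2 * sin y ^ 2 + 9 * cos y ^ 2 * sin x ^ 2) +
        π * (4 * sin x ^ 2 * sin y ^ 2) +
        π * (9 * (sin (3 * x) * sin y + sin x * sin (3 * y)) ^ 2) := by
  have h : (fun z => vorticity₁ u v w x y z ^ 2 + vorticity₂ u v w x y z ^ 2 +
      vorticity₃ u v w x y z ^ 2) = fun z =>
      (4 * cos (3 * x) ^ 2 * sin y ^ 2 + 9 * cos x ^ 2 * sin (3 * y) ^ 2 -
          12 * cos (3 * x) * cos x * sin y * sin (3 * y) + 4 * sin x ^ 2 * cos (3 * y) ^ 2 -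
          12 * sin x * sin (3 * x) * cos (3 * y) * cos y + 9 * cos y ^ 2 * sin (3 * x) ^ 2) *
        sin z ^ 2 +
      (9 * cos x ^ 2 * sin y ^ 2 + 9 * cos y ^ 2 * sin x ^ 2) * sin (3 * z) ^ 2 +
      (18 * cos x ^ 2 * sin (3 * y) * sin y - 12 * cos (3 * x) * cos x * sin y ^ 2 -
          12 * sin x ^ 2 * cos (3 * y) * cos y + 18 * cos y ^ 2 * sin x * sin (3 * x)) *
        (sin z * sin (3 * z)) +
      (4 * sin x ^ 2 * sin y ^ 2) * cos (3 * z) ^ 2 +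
      (9 * (sin (3 * x) * sin y + sin x * sin (3 * y)) ^ 2) * cos z ^ 2 +
      (-12 * sin x * sin y * (sin (3 * x) * sin y + sin x * sin (3 * y))) *
        (cos z * cos (3 * z)) := by
    funext z; rw [vorticity₁_eq, vorticity₂_eq, vorticity₃_eq]; ring
  rw [h, integral_lin6 _ _ _ _ _ _ _ _ _ _ _ _ (by fun_prop) (by fun_prop) (by fun_prop)
    (by fun_prop) (by fun_prop) (by fun_prop), integral_sin_sq_two_pi, integral_sin_three_sq,
    integral_sin_mul_sin_three, integral_cos_three_sq, integral_cos_sq_two_pi,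
    integral_cos_mul_cos_three]
  ring

/-- The `y,z` integral of `|ω|²` is `π² (22 + 14 sin² 3x + 8 sin² x)`. [folklore] -/
theorem integral_yz_vorticity_sq (x : ℝ) :
    ∫ y in (0:ℝ)..2 * π, ∫ z in (0:ℝ)..2 * π, (vorticity₁ u v w x y z ^ 2 +
      vorticity₂ u v w x y z ^ 2 + vorticity₃ u v w x y z ^ 2) =
      π ^ 2 * (22 + 14 * sin (3 * x) ^ 2 + 8 * sin x ^ 2) := by
  have h : (fun y => ∫ z in (0:ℝ)..2 * π, (vorticity₁ u v w x y z ^ 2 +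
      vorticity₂ u v w x y z ^ 2 + vorticity₃ u v w x y z ^ 2)) = fun y =>
      (π * (4 * cos (3 * x) ^ 2 + 9 * cos x ^ 2 + 4 * sin x ^ 2 + 9 * sin (3 * x) ^ 2)) *
        sin y ^ 2 +
      (π * (9 * cos x ^ 2 + 9 * sin x ^ 2)) * sin (3 * y) ^ 2 +
      (π * (-12 * cos (3 * x) * cos x + 18 * sin (3 * x) * sin x)) * (sin y * sin (3 * y)) +
      (π * (4 * sin x ^ 2)) * cos (3 * y) ^ 2 +
      (π * (9 * sin (3 * x) ^ 2 + 9 * sin x ^ 2)) * cos y ^ 2 +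
      (π * (-12 * sin x * sin (3 * x))) * (cos y * cos (3 * y)) := by
    funext y; rw [integral_z_vorticity_sq]; ring
  rw [h, integral_lin6 _ _ _ _ _ _ _ _ _ _ _ _ (by fun_prop) (by fun_prop) (by fun_prop)
    (by fun_prop) (by fun_prop) (by fun_prop), integral_sin_sq_two_pi, integral_sin_three_sq,
    integral_sin_mul_sin_three, integral_cos_three_sq, integral_cos_sq_two_pi,
    integral_cos_mul_cos_three]
  linear_combination (4 * π ^ 2) * sin_sq_add_cos_sq (3 * x) + (18 * π ^ 2) * sin_sq_add_cos_sq x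

/-- `∫∫∫ |ω|² = 66π³` for the Kida–Pelz datum. [folklore] -/
theorem cellIntegral_vorticity_sq :
    cellIntegral (fun x y z => vorticity₁ u v w x y z ^ 2 + vorticity₂ u v w x y z ^ 2 +
      vorticity₃ u v w x y z ^ 2) = 66 * π ^ 3 := by
  unfold cellIntegral
  have h : (fun x => ∫ y in (0:ℝ)..2 * π, ∫ z in (0:ℝ)..2 * π, (vorticity₁ u v w x y z ^ 2 +
      vorticity₂ u v w x y z ^ 2 + vorticity₃ u v w x y z ^ 2)) =
      fun x => (22 * π ^ 2) * 1 + (14 * π ^ 2) * sin (3 * x) ^ 2 + (8 * π ^ 2) * sin x ^ 2 := by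
    funext x; rw [integral_yz_vorticity_sq]; ring
  rw [h, integral_lin3 _ _ _ _ _ _ continuous_const (by fun_prop) (by fun_prop),
    integral_one_two_pi, integral_sin_three_sq, integral_sin_sq_two_pi]
  ring

/-- **`Z(0) = 33/8` for the Kida–Pelz datum** (`½⟨|ω|²⟩ = 11·E(0)`, all energy on
`|k|² = 11`; the `t = 0` end of the enstrophy curves of [cite: CichowlasBrachet2005, Fig. 1],
measured by the cell's GRID on the built field as `Z(0) = 4.1249989` in single precision).
[folklore] -/
theorem cellEnstrophy_eq : cellEnstrophy u v w = 33 / 8 := by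
  unfold cellEnstrophy cellEnergy
  rw [cellMean_eq, cellIntegral_vorticity_sq, div_div, div_eq_iff (by positivity)]
  ring

/-- `Z(0) = 11 E(0)` for the Kida–Pelz datum. [folklore] -/
theorem cellEnstrophy_eq_eleven_mul_cellEnergy :
    cellEnstrophy u v w = 11 * cellEnergy u v w := by
  rw [cellEnstrophy_eq, cellEnergy_eq]; norm_num

/-- Innermost (`z`) integral of the helicity density `u·ω` vanishes (every term is a product of
a `cos` mode and a `sin` mode in `z`). [folklore] -/
theorem integral_z_helicity (x y : ℝ) :
    ∫ z in (0:ℝ)..2 * π, (u x y z * vorticity₁ u v w x y z + v x y z * vorticity₂ u v w x y z +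
      w x y z * vorticity₃ u v w x y z) = 0 := by
  have h : (fun z => u x y z * vorticity₁ u v w x y z + v x y z * vorticity₂ u v w x y z +
      w x y z * vorticity₃ u v w x y z) = fun z =>
      (sin x * cos (3 * y) * (-2 * cos (3 * x) * sin y + 3 * cos x * sin (3 * y)) -
          sin y * cos (3 * x) * (-2 * sin x * cos (3 * y) + 3 * cos y * sin (3 * x)) +
          (cos (3 * x) * cos y - cos x * cos (3 * y)) * 3 * (sin (3 * x) * sin y +
            sin x * sin (3 * y))) * (sin z * cos z) +
      (sin x * cos (3 * y) * 3 * cos x * sin y + sin y * (-(cos (3 * x))) * 3 * cos y * sin x) *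
        (cos z * sin (3 * z)) +
      (sin x * (-(cos y)) * (-2 * cos (3 * x) * sin y + 3 * cos x * sin (3 * y)) +
          sin y * cos x * (-2 * sin x * cos (3 * y) + 3 * cos y * sin (3 * x)) +
          (cos (3 * x) * cos y - cos x * cos (3 * y)) * (-2 * sin x * sin y)) *
        (sin z * cos (3 * z)) +
      (sin x * (-(cos y)) * 3 * cos x * sin y + sin y * cos x * 3 * cos y * sin x) *
        (sin (3 * z) * cos (3 * z)) := by
    funext z; rw [vorticity₁_eq, vorticity₂_eq, vorticity₃_eq]; unfold v w u; ring
  rw [h, integral_lin4 _ _ _ _ _ _ _ _ (by fun_prop) (by fun_prop) (by fun_prop) (by fun_prop),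
    integral_sin_mul_cos, integral_cos_mul_sin_three, integral_sin_mul_cos_three,
    integral_sin_three_mul_cos_three]
  ring

/-- **`H(0) = 0` for the Kida–Pelz datum** (mean helicity; the datum's mirror planes). [folklore] -/
theorem cellHelicity_eq : cellHelicity u v w = 0 := by
  unfold cellHelicity
  rw [cellMean_eq]
  unfold cellIntegral
  have h : (fun x => ∫ y in (0:ℝ)..2 * π, ∫ z in (0:ℝ)..2 * π, (u x y z * vorticity₁ u v w x y z +
      v x y z * vorticity₂ u v w x y z + w x y z * vorticity₃ u v w x y z)) = fun _ => (0:ℝ) := by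
    funext x
    have h' : (fun y => ∫ z in (0:ℝ)..2 * π, (u x y z * vorticity₁ u v w x y z +
        v x y z * vorticity₂ u v w x y z + w x y z * vorticity₃ u v w x y z)) = fun _ => (0:ℝ) :=
      funext fun y => integral_z_helicity x y
    rw [h']; simp
  rw [h]; simp

end KidaPelz

namespace TaylorGreen

/-! ## (v3) Sup norms of the Taylor–Green datum: `‖u‖_∞ = 1`, `‖ω‖_∞ = 2` -/

/-- `sin²x cos²y + cos²x sin²y ≤ 1`. [folklore] -/
theorem sin_sq_cos_sq_add_le_one (x y : ℝ) : sin x ^ 2 * cos y ^ 2 + cos x ^ 2 * sin y ^ 2 ≤ 1 := by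
  nlinarith [sin_sq_add_cos_sq x, sin_sq_add_cos_sq y, mul_nonneg (sq_nonneg (sin x)) (sq_nonneg (sin y)),
    mul_nonneg (sq_nonneg (cos x)) (sq_nonneg (cos y))]

/-- **`|u|² ≤ 1` pointwise** for the Taylor–Green datum. [folklore] -/
theorem speed_sq_le_one (x y z : ℝ) : u x y z ^ 2 + v x y z ^ 2 + w x y z ^ 2 ≤ 1 := by
  have h1 := sin_sq_cos_sq_add_le_one x y
  have hz : cos z ^ 2 ≤ 1 := cos_sq_le_one z
  have e : u x y z ^ 2 + v x y z ^ 2 + w x y z ^ 2 =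
      (sin x ^ 2 * cos y ^ 2 + cos x ^ 2 * sin y ^ 2) * cos z ^ 2 := by unfold u v w; ring
  rw [e]
  have h0 : 0 ≤ sin x ^ 2 * cos y ^ 2 + cos x ^ 2 * sin y ^ 2 := by positivity
  nlinarith [sq_nonneg (cos z)]

/-- … and `|u|² = 1` is attained at `(π/2, 0, 0)`: **`‖u(0)‖_∞ = 1`** (the cell's TG t = 0 sanity
line `‖u‖_∞ = 1`). [folklore] -/
theorem speed_sq_eq_one_at : u (π / 2) 0 0 ^ 2 + v (π / 2) 0 0 ^ 2 + w (π / 2) 0 0 ^ 2 = 1 := by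
  unfold u v w; simp

/-- **`|ω|² ≤ 4` pointwise** for the Taylor–Green datum. [folklore] -/
theorem vorticity_sq_le_four (x y z : ℝ) :
    vorticity₁ u v w x y z ^ 2 + vorticity₂ u v w x y z ^ 2 + vorticity₃ u v w x y z ^ 2 ≤ 4 := by
  rw [vorticity₁_eq, vorticity₂_eq, vorticity₃_eq]
  have h1 := sin_sq_cos_sq_add_le_one x y
  have e : (-(cos x * sin y * sin z)) ^ 2 + (-(sin x * cos y * sin z)) ^ 2 +
      (2 * (sin x * sin y * cos z)) ^ 2 =
      (sin x ^ 2 * cos y ^ 2 + cos x ^ 2 * sin y ^ 2) * sin z ^ 2 +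
        4 * (sin x ^ 2 * sin y ^ 2) * cos z ^ 2 := by ring
  rw [e]
  have hs : sin x ^ 2 * sin y ^ 2 ≤ 1 := by
    nlinarith [sin_sq_le_one x, sin_sq_le_one y, sq_nonneg (sin x), sq_nonneg (sin y),
      mul_nonneg (sq_nonneg (sin x)) (sq_nonneg (sin y))]
  have h0 : 0 ≤ sin x ^ 2 * cos y ^ 2 + cos x ^ 2 * sin y ^ 2 := by positivity
  have h0' : 0 ≤ sin x ^ 2 * sin y ^ 2 := by positivity
  nlinarith [sin_sq_add_cos_sq z, sq_nonneg (sin z), sq_nonneg (cos z)]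

/-- … and `|ω|² = 4` is attained at `(π/2, π/2, 0)`: **`‖ω(0)‖_∞ = 2`** (the cell's TG t = 0
sanity line `‖ω‖_∞ = 2`). [folklore] -/
theorem vorticity_sq_eq_four_at :
    vorticity₁ u v w (π / 2) (π / 2) 0 ^ 2 + vorticity₂ u v w (π / 2) (π / 2) 0 ^ 2 +
      vorticity₃ u v w (π / 2) (π / 2) 0 ^ 2 = 4 := by
  rw [vorticity₁_eq, vorticity₂_eq, vorticity₃_eq]
  simp; norm_num

end TaylorGreen

namespace KidaPelz

/-! ## (v4) Factorised closed forms of the Kida–Pelz datum and vorticity -/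

/-- **Factorised form of the KP velocity**: `u = 4 sin x cos y cos z (sin² z - sin² y)` — so `u`
vanishes on the planes `x ∈ πℤ`, `y ∈ π/2 + πℤ`, `z ∈ π/2 + πℤ` AND on the diagonal planes
`sin² y = sin² z` (`y ≡ ±z mod π`). [folklore] -/
theorem u_eq_factored (x y z : ℝ) :
    u x y z = 4 * sin x * cos y * cos z * (sin z ^ 2 - sin y ^ 2) := by
  unfold u
  rw [cos_three_mul, cos_three_mul]
  have hy := sin_sq_add_cos_sq y
  have hz := sin_sq_add_cos_sq z
  linear_combination (4 * sin x * cos y * cos z) * hy - (4 * sin x * cos y * cos z) * hz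

/-- **Factorised form of the KP vorticity**: `ω₁ = 4 cos x sin y sin z (4 + 2 sin² x - 3 sin² y - 3 sin² z)`
(cyclic for `ω₂`, `ω₃`); at `(0, π/2, π/2)` this is `-8`, the cell's `‖ω(0)‖_∞ = 8`. [folklore] -/
theorem vorticity₁_eq_factored (x y z : ℝ) :
    vorticity₁ u v w x y z =
      4 * cos x * sin y * sin z * (4 + 2 * sin x ^ 2 - 3 * sin y ^ 2 - 3 * sin z ^ 2) := by
  rw [vorticity₁_eq, cos_three_mul, sin_three_mul, sin_three_mul]
  have hx := sin_sq_add_cos_sq x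
  linear_combination (-8 * cos x * sin y * sin z) * hx

/-- `|ω₁| ≤ 8` pointwise (each vorticity component of the KP datum is bounded by `8`). [folklore] -/
theorem abs_vorticity₁_le (x y z : ℝ) : |vorticity₁ u v w x y z| ≤ 8 := by
  rw [vorticity₁_eq]
  have hcx := abs_cos_le_one x
  have hc3 := abs_cos_le_one (3 * x)
  have hsy := abs_sin_le_one y
  have hsz := abs_sin_le_one z
  have hs3y := abs_sin_le_one (3 * y)
  have hs3z := abs_sin_le_one (3 * z)
  have n1 := abs_nonneg (cos (3 * x)); have n2 := abs_nonneg (sin y); have n3 := abs_nonneg (sin z)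
  have n4 := abs_nonneg (cos x); have n5 := abs_nonneg (sin (3 * y)); have n6 := abs_nonneg (sin (3 * z))
  -- first term
  have p1 : |cos (3 * x)| * |sin y| ≤ 1 := by nlinarith
  have p2 : |cos (3 * x)| * |sin y| * |sin z| ≤ 1 := by nlinarith [mul_nonneg n1 n2]
  have h1 : |(-2) * cos (3 * x) * sin y * sin z| ≤ 2 := by
    have e : |(-2) * cos (3 * x) * sin y * sin z| = 2 * (|cos (3 * x)| * |sin y| * |sin z|) := by
      rw [abs_mul, abs_mul, abs_mul]; norm_num; ring
    rw [e]; linarith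
  -- second term
  have q1 : |sin (3 * y) * sin z| ≤ 1 := by rw [abs_mul]; nlinarith
  have q2 : |sin y * sin (3 * z)| ≤ 1 := by rw [abs_mul]; nlinarith
  have hs : |sin (3 * y) * sin z + sin y * sin (3 * z)| ≤ 2 := by
    have := abs_add_le (sin (3 * y) * sin z) (sin y * sin (3 * z)); linarith
  have nA := abs_nonneg (sin (3 * y) * sin z + sin y * sin (3 * z))
  have p3 : |cos x| * |sin (3 * y) * sin z + sin y * sin (3 * z)| ≤ 2 := by nlinarith
  have h2 : |3 * cos x * (sin (3 * y) * sin z + sin y * sin (3 * z))| ≤ 6 := by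
    have e : |3 * cos x * (sin (3 * y) * sin z + sin y * sin (3 * z))| =
        3 * (|cos x| * |sin (3 * y) * sin z + sin y * sin (3 * z)|) := by
      rw [abs_mul, abs_mul]; norm_num; ring
    rw [e]; linarith
  have := abs_add_le (-2 * cos (3 * x) * sin y * sin z)
    (3 * cos x * (sin (3 * y) * sin z + sin y * sin (3 * z)))
  linarith

/-- … and `ω₁ = -8` at `(0, π/2, π/2)` (where `ω₂ = ω₃ = 0`): the cell's KP sanity number
`‖ω(0)‖_∞ = 8` is attained. [folklore] -/
theorem vorticity_at_max :
    vorticity₁ u v w 0 (π / 2) (π / 2) = -8 ∧ vorticity₂ u v w 0 (π / 2) (π / 2) = 0 ∧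
      vorticity₃ u v w 0 (π / 2) (π / 2) = 0 := by
  refine ⟨?_, ?_, ?_⟩
  · rw [vorticity₁_eq_factored]; simp; norm_num
  · rw [vorticity₂_eq]; simp
  · rw [vorticity₃_eq]; simp


/-! ## (v5) The full-vector bound `|ω(0)|² ≤ 64`: the Kida–Pelz sanity number `‖ω(0)‖_∞ = 8` exactly

With `a = sin² x`, `b = sin² y`, `c = sin² z ∈ [0,1]` the factorised forms give
`|ω|² = 16 Σ_cyc (1−a) b c (4 + 2a − 3b − 3c)²`, and the cube inequality `Σ_cyc (1−a) b c (4+2a−3b−3c)² ≤ 4`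
(equality at `(a,b,c) = (0,1,1)`, i.e. at `(0, π/2, π/2)` where `ω = (−8,0,0)`, `vorticity_at_max`) holds
by an explicit HANDELMAN CERTIFICATE: `4 − Σ_cyc …` is a combination with positive rational coefficients of
65 products `aⁱ(1−a)ʲbᵏ(1−b)ˡcᵐ(1−c)ⁿ` of total degree ≤ 6 (found by linear programming — cell pub-fluidc
lit seat gen 18, kit job j068504, script `tools/kp_sup_lp.py`, exact rational reconstruction checked by
sympy; degree 5 is infeasible) — `linarith` re-finds the combination from the 65 products below, so the
certificate is kernel-checked here. (The companion number `‖u(0)‖_∞ = 3√6/4`, i.e.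
`Σ_cyc a(1−b)(1−c)(c−b)² ≤ 27/128` with equality at `(3/4, 3/4, 0)`, has its maximum in the relative
interior of a face, where no Handelman certificate can be tight; it stays untyped.) [folklore] -/

/-- **The cube inequality behind `‖ω(0)‖_∞ = 8`**: for `a, b, c ∈ [0,1]`,
`Σ_cyc (1−a) b c (4+2a−3b−3c)² ≤ 4`. Proof: a degree-6 Handelman certificate with 65 positive rational
coefficients (kit j068504), re-derived by `linarith` from the listed products. [folklore] -/
theorem cube_ineq {a b c : ℝ} (ha : 0 ≤ a) (ha' : a ≤ 1) (hb : 0 ≤ b) (hb' : b ≤ 1) (hc : 0 ≤ c)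
    (hc' : c ≤ 1) :
    (1 - a) * b * c * (4 + 2 * a - 3 * b - 3 * c) ^ 2 + (1 - b) * c * a * (4 + 2 * b - 3 * c - 3 * a) ^ 2 +
      (1 - c) * a * b * (4 + 2 * c - 3 * a - 3 * b) ^ 2 ≤ 4 := by
  have ha1 : 0 ≤ 1 - a := by linarith
  have hb1 : 0 ≤ 1 - b := by linarith
  have hc1 : 0 ≤ 1 - c := by linarith
  linarith [mul_nonneg (hc) (pow_nonneg hc1 5),
    mul_nonneg (pow_nonneg hc 4) (hc1),
    mul_nonneg (pow_nonneg hc 4) (pow_nonneg hc1 2),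
    mul_nonneg (hb1) (pow_nonneg hc1 4),
    mul_nonneg (mul_nonneg (pow_nonneg hb1 3) (hc)) (hc1),
    mul_nonneg (mul_nonneg (hb) (hb1)) (pow_nonneg hc1 3),
    mul_nonneg (mul_nonneg (hb) (pow_nonneg hb1 2)) (pow_nonneg hc 3),
    mul_nonneg (mul_nonneg (pow_nonneg hb 2) (hb1)) (pow_nonneg hc 3),
    mul_nonneg (mul_nonneg (pow_nonneg hb 3) (hc)) (hc1),
    mul_nonneg (ha1) (pow_nonneg hc1 3),
    mul_nonneg (mul_nonneg (ha1) (hb1)) (pow_nonneg hc 3),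
    mul_nonneg (mul_nonneg (ha1) (hb1)) (pow_nonneg hc 4),
    mul_nonneg (ha1) (pow_nonneg hb1 5),
    mul_nonneg (mul_nonneg (ha1) (hb)) (pow_nonneg hc1 4),
    mul_nonneg (mul_nonneg (mul_nonneg (ha1) (pow_nonneg hb 2)) (hb1)) (hc),
    mul_nonneg (mul_nonneg (ha1) (pow_nonneg hb 3)) (pow_nonneg hc1 2),
    mul_nonneg (mul_nonneg (ha1) (pow_nonneg hb 3)) (hb1),
    mul_nonneg (mul_nonneg (ha1) (pow_nonneg hb 3)) (pow_nonneg hb1 2),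
    mul_nonneg (mul_nonneg (pow_nonneg ha1 2) (pow_nonneg hb1 2)) (pow_nonneg hc1 2),
    mul_nonneg (mul_nonneg (mul_nonneg (pow_nonneg ha1 2) (hb)) (pow_nonneg hc 2)) (hc1),
    mul_nonneg (mul_nonneg (mul_nonneg (pow_nonneg ha1 2) (pow_nonneg hb 2)) (hb1)) (hc),
    mul_nonneg (pow_nonneg ha1 4) (hc1),
    mul_nonneg (mul_nonneg (pow_nonneg ha1 4) (hb1)) (hc),
    mul_nonneg (mul_nonneg (pow_nonneg ha1 4) (hb)) (hc1),
    mul_nonneg (mul_nonneg (pow_nonneg ha1 4) (hb)) (hb1),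
    mul_nonneg (pow_nonneg ha1 5) (hc1),
    mul_nonneg (mul_nonneg (ha) (hb1)) (pow_nonneg hc1 4),
    mul_nonneg (mul_nonneg (mul_nonneg (ha) (hb1)) (pow_nonneg hc 3)) (hc1),
    mul_nonneg (mul_nonneg (ha) (pow_nonneg hb1 4)) (hc1),
    mul_nonneg (mul_nonneg (mul_nonneg (ha) (hb)) (hc)) (pow_nonneg hc1 3),
    mul_nonneg (mul_nonneg (ha) (hb)) (pow_nonneg hc 4),
    mul_nonneg (mul_nonneg (mul_nonneg (ha) (hb)) (pow_nonneg hb1 2)) (pow_nonneg hc 2),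
    mul_nonneg (mul_nonneg (mul_nonneg (ha) (hb)) (pow_nonneg hb1 3)) (hc),
    mul_nonneg (mul_nonneg (mul_nonneg (ha) (pow_nonneg hb 2)) (hb1)) (hc1),
    mul_nonneg (mul_nonneg (mul_nonneg (ha) (pow_nonneg hb 3)) (hb1)) (hc1),
    mul_nonneg (mul_nonneg (ha) (pow_nonneg hb 4)) (hc),
    mul_nonneg (mul_nonneg (ha) (ha1)) (pow_nonneg hc1 4),
    mul_nonneg (mul_nonneg (ha) (ha1)) (pow_nonneg hc 3),
    mul_nonneg (mul_nonneg (mul_nonneg (ha) (ha1)) (pow_nonneg hc 3)) (hc1),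
    mul_nonneg (mul_nonneg (mul_nonneg (ha) (ha1)) (hb1)) (pow_nonneg hc 3),
    mul_nonneg (mul_nonneg (mul_nonneg (ha) (ha1)) (pow_nonneg hb1 3)) (hc),
    mul_nonneg (mul_nonneg (ha) (ha1)) (pow_nonneg hb1 4),
    mul_nonneg (mul_nonneg (mul_nonneg (ha) (ha1)) (hb)) (pow_nonneg hc1 3),
    mul_nonneg (mul_nonneg (ha) (ha1)) (pow_nonneg hb 3),
    mul_nonneg (ha) (pow_nonneg ha1 5),
    mul_nonneg (mul_nonneg (pow_nonneg ha 2) (hc)) (hc1),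
    mul_nonneg (mul_nonneg (pow_nonneg ha 2) (pow_nonneg hc 2)) (pow_nonneg hc1 2),
    mul_nonneg (mul_nonneg (mul_nonneg (pow_nonneg ha 2) (hb1)) (pow_nonneg hc 2)) (hc1),
    mul_nonneg (mul_nonneg (mul_nonneg (pow_nonneg ha 2) (pow_nonneg hb1 2)) (hc)) (hc1),
    mul_nonneg (mul_nonneg (mul_nonneg (pow_nonneg ha 2) (hb)) (hc)) (pow_nonneg hc1 2),
    mul_nonneg (mul_nonneg (pow_nonneg ha 2) (hb)) (hb1),
    mul_nonneg (mul_nonneg (pow_nonneg ha 2) (hb)) (pow_nonneg hb1 2),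
    mul_nonneg (mul_nonneg (pow_nonneg ha 2) (pow_nonneg hb 2)) (pow_nonneg hb1 2),
    mul_nonneg (mul_nonneg (pow_nonneg ha 2) (ha1)) (pow_nonneg hb1 2),
    mul_nonneg (mul_nonneg (mul_nonneg (pow_nonneg ha 2) (ha1)) (pow_nonneg hb1 2)) (hc),
    mul_nonneg (mul_nonneg (mul_nonneg (pow_nonneg ha 2) (ha1)) (pow_nonneg hb 2)) (hc1),
    mul_nonneg (mul_nonneg (pow_nonneg ha 3) (hb)) (hb1),
    mul_nonneg (mul_nonneg (mul_nonneg (pow_nonneg ha 3) (ha1)) (hb1)) (hc),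
    mul_nonneg (mul_nonneg (mul_nonneg (pow_nonneg ha 3) (ha1)) (hb)) (hc1),
    mul_nonneg (mul_nonneg (mul_nonneg (pow_nonneg ha 3) (ha1)) (hb)) (hb1),
    mul_nonneg (mul_nonneg (pow_nonneg ha 4) (hb1)) (hc1),
    mul_nonneg (mul_nonneg (pow_nonneg ha 4) (hb)) (hc),
    mul_nonneg (pow_nonneg ha 4) (ha1),
    mul_nonneg (mul_nonneg (pow_nonneg ha 4) (ha1)) (hc),
    mul_nonneg (pow_nonneg ha 4) (pow_nonneg ha1 2)]

/-- **`|ω(0)|² ≤ 64` pointwise for the Kida–Pelz datum** — with `vorticity_at_max` (`ω(0,π/2,π/2) = (−8,0,0)`)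
the cell's sanity number `‖ω(0)‖_∞ = 8` is exact for the full vorticity vector, not only componentwise
(`abs_vorticity₁_le`). [folklore] -/
theorem vorticity_sq_le (x y z : ℝ) :
    vorticity₁ u v w x y z ^ 2 + vorticity₂ u v w x y z ^ 2 + vorticity₃ u v w x y z ^ 2 ≤ 64 := by
  have key := cube_ineq (a := sin x ^ 2) (b := sin y ^ 2) (c := sin z ^ 2) (sq_nonneg _) (sin_sq_le_one x)
    (sq_nonneg _) (sin_sq_le_one y) (sq_nonneg _) (sin_sq_le_one z)
  have e : vorticity₁ u v w x y z ^ 2 + vorticity₂ u v w x y z ^ 2 + vorticity₃ u v w x y z ^ 2 =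
      16 * (cos x ^ 2 * sin y ^ 2 * sin z ^ 2 * (4 + 2 * sin x ^ 2 - 3 * sin y ^ 2 - 3 * sin z ^ 2) ^ 2 +
        cos y ^ 2 * sin z ^ 2 * sin x ^ 2 * (4 + 2 * sin y ^ 2 - 3 * sin z ^ 2 - 3 * sin x ^ 2) ^ 2 +
        cos z ^ 2 * sin x ^ 2 * sin y ^ 2 * (4 + 2 * sin z ^ 2 - 3 * sin x ^ 2 - 3 * sin y ^ 2) ^ 2) := by
    rw [vorticity₂_eq_vorticity₁, vorticity₃_eq_vorticity₁, vorticity₁_eq_factored, vorticity₁_eq_factored,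
      vorticity₁_eq_factored]
    ring
  rw [e, cos_sq' x, cos_sq' y, cos_sq' z]
  linarith [key]

/-- … attained: `|ω(0, π/2, π/2)|² = 64`. [folklore] -/
theorem vorticity_sq_eq_at_max :
    vorticity₁ u v w 0 (π / 2) (π / 2) ^ 2 + vorticity₂ u v w 0 (π / 2) (π / 2) ^ 2 +
      vorticity₃ u v w 0 (π / 2) (π / 2) ^ 2 = 64 := by
  obtain ⟨h1, h2, h3⟩ := vorticity_at_max
  rw [h1, h2, h3]
  norm_num

end KidaPelz

end Literature.Analysis.FluidPDE.FluidComputer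

end
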